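import Literature.MathematicalPhysics.QuantumLattice.PeierlsHubbardReflectionPositivity
import HarnessLib

/-!
# The stability of the Peierls instability for ring-shaped molecules (Lieb–Nachtergaele 1995)

E. H. Lieb, B. Nachtergaele, *Stability of the Peierls instability for ring-shaped molecules*,
Phys. Rev. B **51** (1995) 4777–4791 (= arXiv:cond-mat/9410100) [LiebNachtergaele1995].

**Setting** (§1, eqs. (1.1)–(1.5)). `L` electrons (`L` even) on a ring of `L` sites with the
half-filled Hubbard Hamiltonian
`H({t_j}) = -Σ_{j,σ} t_j c†_{j+1,σ} c_{j,σ} + h.c. + U Σ_j (n_{j↑} - ½)(n_{j↓} - ½)` (any real `U`),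
complex bond amplitudes `t_j` (a magnetic flux `Φ = arg Π_j t_j` is allowed), an arbitrary elastic
energy `f(|t_j|)` per bond, and the total energy
`𝓔_L({t_j}) = λ₀(H({t_j})) + Σ_j f(|t_j|)` (eq. (1.3)), `λ₀` = the lowest eigenvalue over all of
Fock space (§2: for real `t` and `U ≠ 0` the ground state is half filled anyway). A configuration
is *dimerized* if it has period two, `t_{j+2} = t_j` (eq. (1.4), period one included).

**Results formalised here** (all `U`, all `f`, even `L ≥ 4`):

* `energy_reflL_add_energy_reflR_le` — **Lemma 3.1 (`RPineq`)**:
  `𝓔_L(t^l,t^m,t^r) ≥ ½(𝓔_L(t^l,t^m,θt^l) + 𝓔_L(θt^r,t^m,t^r))` for the reflection through the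
  plane through the two bonds `t^m` when these are real and nonnegative (the reflected half
  carries `-t̄`, Lieb's `Θ(K_L) = -R(K_L)`), from the tree's fermionic reflection positivity
  `LiebCutRP.groundEnergy_add_le_two_mul` (Lieb 1994, Lemma) on the ring `d + 1 = 1`; and at every
  translate of the plane (`energy_reflLAt_add_energy_reflRAt_le`);
* `energy_gauge` — gauge invariance (§1, "the energy levels depend only on the total flux");
* **Theorem 1 (i)** `exists_dimerized_minimizer_of_mod_four_eq_two` — if `L ≡ 2 (mod 4)` and the
  minimum of `𝓔_L` over all complex configurations is attained (at `t`), then it is attained at a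
  DIMERIZED configuration with all `t_j` real and nonnegative (flux `0`);
* **Theorem 1 (ii)** `exists_dimerized_minimizer_of_four_dvd` — if `L ≡ 0 (mod 4)`, it is attained
  at a real configuration whose moduli are dimerized and with one distinguished bond `t_{j₁} ≤ 0`,
  all others `≥ 0` (flux `π`).

The proof is the printed one (§3, proof of Theorem 1): a minimiser stays a minimiser under both
reflections (equality in `RPineq`); the reflected configurations have the canonical flux
(`hasCanonicalFlux_reflL`); and "either `(t^l,t^m,θt^l)` or `(θt^r,t^m,t^r)` … has at least as many
pairs of identical `|t_j|`'s", made quantitative by `two_mul_pairCount_add_two_le`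
(`N(LL) + N(RR) ≥ 2N(t) + 2` for `N(t) = #{j : |t_{j+2}| = |t_j|}` when a pair straddling the plane is
unequal); "because `𝓔_L` is translation invariant the argument can be repeated"
(`energy_translate`); the final gauge normal form is `gauge_nfGauge_of_ne`.

Also: the **flux-phase Corollary** (`fluxphase`, after Lemma 3.1) in the case `RPineq` yields —
moduli symmetric under one reflection through bonds (uniform, dimerized, …), all real `U`:
`exists_canonicalFlux_groundEnergy_le`, `groundEnergy_le_of_hasCanonicalFlux` (the canonical flux
`0` resp. `π` minimises `λ₀` over the flux), with `groundEnergy_eq_of_norm_eq_of_bondProd_eq`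
("the energy levels depend only on `{|t_j|}` and `Φ`").

What is NOT formalised: Theorem 2 (uniqueness), Theorem 3 (asymptotic dimerization for
`L ≡ 0 mod 4`), the Corollary for arbitrary (non-symmetric) moduli (no proof printed), the
existence of a minimiser from the growth condition (1.6) on `f` (the theorems below are stated,
as printed, for an attained minimum), §2.

## References

* [LiebNachtergaele1995] E. H. Lieb, B. Nachtergaele, Phys. Rev. B 51 (1995) 4777, §1 eqs.
  (1.1)–(1.6), Theorem 1 (`global`), §3 Lemma 3.1 (`RPineq`) and the proof of Theorem 1.
* [Lieb1994] E. H. Lieb, Phys. Rev. Lett. 73 (1994) 2158, Lemma and eq. (4), Remark (iii).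
* [KennedyLieb1987] T. Kennedy, E. H. Lieb, Phys. Rev. Lett. 59 (1987) 1309 (the `U = 0`,
  quadratic-`f` case, all even `L`; not used here).
-/

noncomputable section

/-! ### Ground energies from partition functions -/

namespace Matrix

open Literature.MathematicalPhysics.QuantumLattice

variable {m : Type*} [Fintype m] [DecidableEq m] [Nonempty m]

/-- If `Re Z_β(A) ≤ Re Z_β(B)` for all `β > 0` then `E₀(B) ≤ E₀(A)` (`β → ∞` in
`E₀(B) ≤ E₀(A) + (log D)/β`). [cite: Lieb1994, Remark (iii)] -/
theorem groundEnergy_le_of_forall_partitionFn_le {A B : Matrix m m ℂ} (hA : A.IsHermitian)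
    (hB : B.IsHermitian) (h : ∀ β : ℝ, 0 < β → (A.partitionFn β).re ≤ (B.partitionFn β).re) :
    B.groundEnergy ≤ A.groundEnergy := by
  refine le_of_forall_pos_le_add fun ε hε => ?_
  have hD : (1 : ℝ) ≤ Fintype.card m := by exact_mod_cast Fintype.card_pos
  have hlog : 0 ≤ Real.log (Fintype.card m) := Real.log_nonneg hD
  set β : ℝ := (Real.log (Fintype.card m) + 1) / ε with hβdef
  have hβ : 0 < β := div_pos (by linarith) hε
  have h1 := groundEnergy_le_of_partitionFn_le hA hB hβ (h β hβ)
  have h2 : Real.log (Fintype.card m) / β ≤ ε := by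
    rw [div_le_iff₀ hβ]
    have : ε * β = Real.log (Fintype.card m) + 1 := by
      rw [hβdef, mul_div_assoc']
      exact mul_div_cancel_left₀ _ hε.ne'
    linarith
  linarith

/-- If `Re Z_β(A) = Re Z_β(B)` for all `β > 0` then `E₀(A) = E₀(B)`. [cite: Lieb1994, Remark (iii)] -/
theorem groundEnergy_eq_of_forall_partitionFn_eq {A B : Matrix m m ℂ} (hA : A.IsHermitian)
    (hB : B.IsHermitian) (h : ∀ β : ℝ, 0 < β → (A.partitionFn β).re = (B.partitionFn β).re) :
    A.groundEnergy = B.groundEnergy :=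
  le_antisymm (groundEnergy_le_of_forall_partitionFn_le hB hA fun β hβ => (h β hβ).symm.le)
    (groundEnergy_le_of_forall_partitionFn_le hA hB fun β hβ => (h β hβ).le)

end Matrix

namespace Literature.MathematicalPhysics.QuantumLattice

open Matrix Finset HubbardWave0 FermionTorus Literature.Probability.LatticeModels
open scoped ComplexOrder

namespace PeierlsRing

attribute [local instance] LiebCutRP.decEqTorus

variable {L : ℕ} [NeZero L]

/-! ### The ring: sites indexed by `ZMod L`, bonds `j ↔ {j, j+1}` -/

/-- Site `j` of the ring `ℤ/Lℤ` as a point of the fermionic torus `FermionTorus 1 L`.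
[cite: LiebNachtergaele1995, §1 (ring of `L` sites, `L + 1 ≡ 1`)] -/
def site (j : ZMod L) : FermionTorus 1 L := FermionTorus.ofTorusSite (fun _ : Fin 1 => j)

/-- The coordinate of `site j` is `j`. [cite: LiebNachtergaele1995, §1] -/
@[simp] theorem toTorusSite_site (j : ZMod L) : toTorusSite (site j) 0 = j := by
  rw [site, toTorusSite_ofTorusSite]

/-- Every point of the ring is `site` of its coordinate. [cite: LiebNachtergaele1995, §1] -/
theorem site_toTorusSite (x : FermionTorus 1 L) : site (toTorusSite x 0) = x := by
  have h : (fun _ : Fin 1 => toTorusSite x 0) = toTorusSite x := by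
    funext i; rw [Fin.fin_one_eq_zero i]
  rw [site, h, ofTorusSite_toTorusSite]

/-- `site` is injective. [cite: LiebNachtergaele1995, §1] -/
theorem site_injective : Function.Injective (site (L := L)) := fun a b h => by
  rw [← toTorusSite_site (L := L) a, h, toTorusSite_site]

/-- `site (j + 1) = site j + e₀`. [cite: LiebNachtergaele1995, §1] -/
theorem site_add_one (j : ZMod L) : site (j + 1) = shift (site j) 0 := by
  apply toTorusSite_injective
  funext i
  rw [Fin.fin_one_eq_zero i, toTorusSite_shift, Pi.add_apply, toTorusSite_site, toTorusSite_site,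
    Pi.single_eq_same]

/-- `site (j - 1) = site j - e₀`. [cite: LiebNachtergaele1995, §1] -/
theorem site_sub_one (j : ZMod L) : site (j - 1) = unshift (site j) 0 := by
  have h := site_add_one (L := L) (j - 1)
  rw [sub_add_cancel] at h
  rw [h, unshift_shift]

/-- The cut coordinate of `site j` is the canonical representative of `j`.
[cite: LiebNachtergaele1995, §3 (Fig. 1)] -/
theorem col_site (j : ZMod L) : Cut.col (site j) = j.val := rfl

/-- `site j` is in the left half iff `j ∈ {0, …, L/2 - 1}`. [cite: LiebNachtergaele1995, §3 (Fig. 1)] -/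
theorem isLeft_site_iff (j : ZMod L) : Cut.IsLeft L (site j) ↔ j.val < L / 2 := Iff.rfl

/-- The mirror image of `site j` through the standard plane (through the bonds `{-1, 0}` and
`{L/2 - 1, L/2}`) is `site (-j - 1)`. [cite: LiebNachtergaele1995, §3 (Fig. 1)] -/
theorem reflect_site (j : ZMod L) : Cut.reflect (site j) = site (-j - 1) := by
  apply toTorusSite_injective
  funext i
  rw [Fin.fin_one_eq_zero i, Cut.toTorusSite_reflect_zero, toTorusSite_site, toTorusSite_site]

omit [NeZero L] in
/-- `2 ≠ 0` in `ℤ/Lℤ` for `L ≥ 3`. [cite: LiebNachtergaele1995, §1] -/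
theorem two_ne_zero (h3 : 3 ≤ L) : (2 : ZMod L) ≠ 0 := by
  rw [show (2 : ZMod L) = ((2 : ℕ) : ZMod L) by norm_cast, Ne, ZMod.natCast_eq_zero_iff]
  intro h
  have := Nat.le_of_dvd (by norm_num) h
  omega

omit [NeZero L] in
/-- `b = a + 1` and `a = b + 1` cannot both hold (`L ≥ 3`). [cite: LiebNachtergaele1995, §1] -/
theorem not_both_succ (h3 : 3 ≤ L) {a b : ZMod L} (h₁ : b = a + 1) (h₂ : a = b + 1) : False := by
  apply two_ne_zero h3
  have : a = a + 2 := by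
    conv_lhs => rw [h₂, h₁]
    ring
  linear_combination -this

/-- **Nearest neighbours on the ring**: `site a ∼ site b ↔ b = a + 1 ∨ a = b + 1` (`L ≥ 3`).
[cite: LiebNachtergaele1995, §1] -/
theorem adj_site_iff (h3 : 3 ≤ L) (a b : ZMod L) :
    (fermionTorusGraph 1 L).Adj (site a) (site b) ↔ b = a + 1 ∨ a = b + 1 := by
  rw [adj_iff_shift_or_unshift (by omega)]
  constructor
  · rintro (⟨μ, h⟩ | ⟨μ, h⟩)
    · rw [Fin.fin_one_eq_zero μ, ← site_add_one] at h
      exact Or.inl (site_injective h).symm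
    · rw [Fin.fin_one_eq_zero μ, ← site_sub_one] at h
      refine Or.inr ?_
      rw [← site_injective h, sub_add_cancel]
  · rintro (h | h)
    · exact Or.inl ⟨0, by rw [← site_add_one, h]⟩
    · exact Or.inr ⟨0, by rw [← site_sub_one, h, add_sub_cancel_right]⟩

/-- `(j + 1).val = (j.val + 1) mod L` (`L ≥ 2`). [cite: LiebNachtergaele1995, §1] -/
theorem val_add_one (h2 : 2 ≤ L) (j : ZMod L) : (j + 1).val = (j.val + 1) % L := by
  rw [ZMod.val_add, ZMod.val_one_eq_one_mod, Nat.mod_eq_of_lt (show 1 < L by omega)]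

/-- `(j + 2).val = (j.val + 2) mod L` (`L ≥ 3`). [cite: LiebNachtergaele1995, §1] -/
theorem val_add_two (h3 : 3 ≤ L) (j : ZMod L) : (j + 2).val = (j.val + 2) % L := by
  rw [show j + 2 = j + 1 + 1 by ring, val_add_one (by omega), val_add_one (by omega), Nat.add_mod,
    Nat.mod_mod, ← Nat.add_mod]

omit [NeZero L] in
/-- `-(L/2) = L/2` in `ℤ/Lℤ` for even `L`. [cite: LiebNachtergaele1995, §3] -/
theorem neg_half (hL : Even L) : -((L / 2 : ℕ) : ZMod L) = (L / 2 : ℕ) := by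
  obtain ⟨k, hk⟩ := hL
  have hk2 : L / 2 = k := by omega
  rw [hk2, neg_eq_iff_add_eq_zero, ← Nat.cast_add, ← hk, ZMod.natCast_self]

omit [NeZero L] in
/-- `L/2 ∉ {0, 1, -1}` in `ℤ/Lℤ` (`L ≥ 4`). [cite: LiebNachtergaele1995, §3] -/
theorem half_ne (h4 : 4 ≤ L) :
    ((L / 2 : ℕ) : ZMod L) ≠ 0 ∧ ((L / 2 : ℕ) : ZMod L) ≠ 1 ∧ ((L / 2 : ℕ) : ZMod L) + 1 ≠ 0 := by
  refine ⟨fun h => ?_, fun h => ?_, fun h => ?_⟩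
  · rw [ZMod.natCast_eq_zero_iff] at h
    have := Nat.le_of_dvd (by omega) h
    omega
  · have := congrArg ZMod.val h
    rw [ZMod.val_natCast, Nat.mod_eq_of_lt (by omega), ZMod.val_one_eq_one_mod,
      Nat.mod_eq_of_lt (show 1 < L by omega)] at this
    omega
  · rw [← Nat.cast_add_one, ZMod.natCast_eq_zero_iff] at h
    have := Nat.le_of_dvd (by omega) h
    omega

omit [NeZero L] in
/-- `(-1).val = L - 1`. [cite: LiebNachtergaele1995, §1] -/
theorem val_neg_one (h2 : 2 ≤ L) : (-1 : ZMod L).val = L - 1 := by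
  have h : (-1 : ZMod L) = ((L - 1 : ℕ) : ZMod L) := by
    rw [Nat.cast_sub (by omega), Nat.cast_one, ZMod.natCast_self, zero_sub]
  rw [h, ZMod.val_natCast, Nat.mod_eq_of_lt (by omega)]

omit [NeZero L] in
/-- `(L/2 - 1).val = L/2 - 1` (`L ≥ 2`). [cite: LiebNachtergaele1995, §3] -/
theorem val_half_sub_one (h2 : 2 ≤ L) : (((L / 2 : ℕ) : ZMod L) - 1).val = L / 2 - 1 := by
  have h : ((L / 2 : ℕ) : ZMod L) - 1 = ((L / 2 - 1 : ℕ) : ZMod L) := by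
    rw [Nat.cast_sub (by omega), Nat.cast_one]
  rw [h, ZMod.val_natCast, Nat.mod_eq_of_lt (by omega)]

/-! ### The Hamiltonian and the energy functional -/

/-- **The hopping amplitudes of the ring** from bond amplitudes `t : ℤ/Lℤ → ℂ`: amplitude `t_j` on
`c†_{j+1,σ} c_{j,σ}`, `t̄_j` on `c†_{j,σ}c_{j+1,σ}`, spin independent (eq. (1.1)).
[cite: LiebNachtergaele1995, eq. (1.1)] -/
def ringAmpl (t : ZMod L → ℂ) : Fin 2 → FermionTorus 1 L → FermionTorus 1 L → ℂ :=
  fun _ x y => if toTorusSite x 0 = toTorusSite y 0 + 1 then t (toTorusSite y 0)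
    else if toTorusSite y 0 = toTorusSite x 0 + 1 then star (t (toTorusSite x 0)) else 0

/-- Unfolding lemma on sites. [cite: LiebNachtergaele1995, eq. (1.1)] -/
theorem ringAmpl_site (t : ZMod L → ℂ) (σ : Fin 2) (a b : ZMod L) :
    ringAmpl t σ (site a) (site b) =
      if a = b + 1 then t b else if b = a + 1 then star (t a) else 0 := by
  simp only [ringAmpl, toTorusSite_site]

/-- The hopping amplitudes are Hermitian (`L ≥ 3`). [cite: LiebNachtergaele1995, eq. (1.1)] -/
theorem ringAmpl_herm (h3 : 3 ≤ L) (t : ZMod L → ℂ) (σ : Fin 2) (x y : FermionTorus 1 L) :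
    ringAmpl t σ y x = star (ringAmpl t σ x y) := by
  rw [← site_toTorusSite x, ← site_toTorusSite y, ringAmpl_site, ringAmpl_site]
  set a := toTorusSite x 0
  set b := toTorusSite y 0
  by_cases h₁ : b = a + 1
  · rw [if_pos h₁, if_neg (fun h₂ => not_both_succ h3 h₁ h₂), if_pos h₁, star_star]
  · rw [if_neg h₁]
    by_cases h₂ : a = b + 1
    · rw [if_pos h₂, if_pos h₂]
    · rw [if_neg h₂, if_neg h₂, if_neg h₁, star_zero]

/-- **The Peierls–Hubbard Hamiltonian of the ring** (eq. (1.1)):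
`H({t_j}) = -Σ_{j,σ} (t_j c†_{j+1,σ}c_{j,σ} + h.c.) + U Σ_j (n_{j↑} - ½)(n_{j↓} - ½)`.
[cite: LiebNachtergaele1995, eq. (1.1)] -/
def hamiltonian (U : ℝ) (t : ZMod L → ℂ) :
    Matrix (Finset (Orb (FermionTorus 1 L))) (Finset (Orb (FermionTorus 1 L))) ℂ :=
  peierlsHubbard (fermionTorusGraph 1 L) (ringAmpl t) U

/-- The Hamiltonian is Hermitian. [cite: LiebNachtergaele1995, eq. (1.1)] -/
theorem hamiltonian_isHermitian (h3 : 3 ≤ L) (U : ℝ) (t : ZMod L → ℂ) :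
    (hamiltonian U t).IsHermitian :=
  peierlsHubbard_isHermitian _ _ (ringAmpl_herm h3 t) U

/-- **The energy functional** `𝓔_L({t_j}) = λ₀(H({t_j})) + Σ_j f(|t_j|)` (eq. (1.3)), `λ₀` the lowest
eigenvalue over all of Fock space. [cite: LiebNachtergaele1995, eq. (1.3)] -/
def energy (f : ℝ → ℝ) (U : ℝ) (t : ZMod L → ℂ) : ℝ :=
  (hamiltonian U t).groundEnergy + ∑ j, f ‖t j‖

/-- **Dimerized configurations**: period two (eq. (1.4); "a dimerized configuration is one with
period-two translation invariance, and this includes period one"). [cite: LiebNachtergaele1995, eq. (1.4)] -/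
def IsDimerized {α : Type*} (t : ZMod L → α) : Prop := ∀ j, t (j + 2) = t j

/-- A configuration is a **minimiser** of `𝓔_L` (eq. (1.2): the minimum over all `{|t_j|}` and all
phases). [cite: LiebNachtergaele1995, eq. (1.2)] -/
def IsMinimizer (f : ℝ → ℝ) (U : ℝ) (t : ZMod L → ℂ) : Prop :=
  ∀ s : ZMod L → ℂ, energy f U t ≤ energy f U s

/-! ### Gauge invariance -/

/-- The gauge transform of the bond amplitudes by site phases `g`: `t'_j = g_{j+1} ḡ_j t_j`
(`c_{jσ} → e^{iφ_j} c_{jσ}`). [cite: LiebNachtergaele1995, §1 (gauge transformation)] -/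
def gauge (g : ZMod L → ℂ) (t : ZMod L → ℂ) : ZMod L → ℂ := fun j => g (j + 1) * star (g j) * t j

omit [NeZero L] in
/-- The gauged amplitudes are Lieb's gauge transform of the hopping amplitudes.
[cite: LiebNachtergaele1995, §1] [cite: Lieb1994, p. 3] -/
theorem ringAmpl_gauge (g : ZMod L → ℂ) (t : ZMod L → ℂ) :
    ringAmpl (gauge g t) = fun σ x y =>
      g (toTorusSite x 0) * star (g (toTorusSite y 0)) * ringAmpl t σ x y := by
  funext σ x y
  simp only [ringAmpl, gauge]
  split_ifs with h₁ h₂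
  · rw [h₁]
  · rw [h₂, star_mul, star_mul, star_star]; ring
  · rw [mul_zero]

omit [NeZero L] in
/-- Moduli are gauge invariant. [cite: LiebNachtergaele1995, §1] -/
theorem norm_gauge {g : ZMod L → ℂ} (hg : ∀ j, ‖g j‖ = 1) (t : ZMod L → ℂ) (j : ZMod L) :
    ‖gauge g t j‖ = ‖t j‖ := by
  rw [gauge, norm_mul, norm_mul, norm_star, hg, hg, one_mul, one_mul]

/-- **Gauge invariance of the energy**: "by a simple unitary gauge transformation … the energy
levels of `H` are unchanged". [cite: LiebNachtergaele1995, §1] -/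
theorem energy_gauge (h3 : 3 ≤ L) {g : ZMod L → ℂ} (hg : ∀ j, ‖g j‖ = 1) (f : ℝ → ℝ) (U : ℝ)
    (t : ZMod L → ℂ) : energy f U (gauge g t) = energy f U t := by
  unfold energy
  have hE : (hamiltonian U (gauge g t)).groundEnergy = (hamiltonian U t).groundEnergy := by
    haveI : Nonempty (Finset (Orb (FermionTorus 1 L))) := ⟨∅⟩
    refine Matrix.groundEnergy_eq_of_forall_partitionFn_eq (hamiltonian_isHermitian h3 U _)
      (hamiltonian_isHermitian h3 U _) fun β _ => ?_
    unfold hamiltonian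
    rw [ringAmpl_gauge]
    exact congrArg Complex.re (partitionFn_peierlsHubbard_gauge _ (fun _ x => g (toTorusSite x 0))
      (fun _ _ => hg _) (ringAmpl t) U β)
  rw [hE]
  simp only [norm_gauge hg]

/-- The product of the bond amplitudes `Π_j t_j` (its argument is the total flux `Φ`).
[cite: LiebNachtergaele1995, §1 (total flux)] -/
def bondProd (t : ZMod L → ℂ) : ℂ := ∏ j, t j

/-- **The flux is gauge invariant**: `Π_j t'_j = Π_j t_j`. [cite: LiebNachtergaele1995, §1] -/
theorem bondProd_gauge {g : ZMod L → ℂ} (hg : ∀ j, ‖g j‖ = 1) (t : ZMod L → ℂ) :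
    bondProd (gauge g t) = bondProd t := by
  unfold bondProd gauge
  rw [prod_mul_distrib, prod_mul_distrib, ← star_prod,
    Fintype.prod_equiv (Equiv.addRight 1) (fun j => g (j + 1)) g (fun _ => rfl),
    Complex.star_def, Complex.mul_conj', Complex.norm_prod]
  simp only [hg, prod_const_one, one_pow, Complex.ofReal_one, one_mul]

/-! ### Translation invariance -/

/-- The translate of a configuration by `v` bonds: `(τ_v t)_j = t_{j - v}`.
[cite: LiebNachtergaele1995, §3 ("`𝓔_L` is translation invariant")] -/
def translate (v : ZMod L) (t : ZMod L → ℂ) : ZMod L → ℂ := fun j => t (j - v)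

omit [NeZero L] in
/-- Unfolding lemma. [cite: LiebNachtergaele1995, §3] -/
theorem translate_apply (v : ZMod L) (t : ZMod L → ℂ) (j : ZMod L) : translate v t j = t (j - v) := rfl

/-- The translated amplitudes are the relabelled ones along the torus translation.
[cite: LiebNachtergaele1995, §3] -/
theorem ringAmpl_translate (v : ZMod L) (t : ZMod L → ℂ) :
    ringAmpl (translate v t) = fun σ x y =>
      ringAmpl t σ ((ofTorusEquiv (Equiv.addRight (fun _ : Fin 1 => v))).symm x)
        ((ofTorusEquiv (Equiv.addRight (fun _ : Fin 1 => v))).symm y) := by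
  have hc : ∀ z : FermionTorus 1 L,
      toTorusSite ((ofTorusEquiv (Equiv.addRight (fun _ : Fin 1 => v))).symm z) 0 =
        toTorusSite z 0 - v := fun z => by
    have h := toTorusSite_ofTorusEquiv (Equiv.addRight (fun _ : Fin 1 => v))
      ((ofTorusEquiv (Equiv.addRight (fun _ : Fin 1 => v))).symm z)
    rw [Equiv.apply_symm_apply] at h
    have h0 := congrFun h 0
    simp only [Equiv.coe_addRight, Pi.add_apply] at h0
    linear_combination -h0
  funext σ x y
  simp only [ringAmpl, translate, hc]
  have e1 : (toTorusSite x 0 - v = toTorusSite y 0 - v + 1) ↔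
      (toTorusSite x 0 = toTorusSite y 0 + 1) := by
    constructor <;> intro h <;> linear_combination h
  have e2 : (toTorusSite y 0 - v = toTorusSite x 0 - v + 1) ↔
      (toTorusSite y 0 = toTorusSite x 0 + 1) := by
    constructor <;> intro h <;> linear_combination h
  simp only [e1, e2]

/-- **Translation invariance of the energy.**
[cite: LiebNachtergaele1995, §3 ("`𝓔_L` is translation invariant")] -/
theorem energy_translate (h3 : 3 ≤ L) (f : ℝ → ℝ) (U : ℝ) (v : ZMod L) (t : ZMod L → ℂ) :
    energy f U (translate v t) = energy f U t := by
  unfold energy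
  have hE : (hamiltonian U (translate v t)).groundEnergy = (hamiltonian U t).groundEnergy := by
    haveI : Nonempty (Finset (Orb (FermionTorus 1 L))) := ⟨∅⟩
    refine Matrix.groundEnergy_eq_of_forall_partitionFn_eq (hamiltonian_isHermitian h3 U _)
      (hamiltonian_isHermitian h3 U _) fun β _ => ?_
    unfold hamiltonian
    rw [ringAmpl_translate]
    exact congrArg Complex.re (partitionFn_peierlsHubbard_relabel _ _
      (ofTorusEquiv (Equiv.addRight (fun _ : Fin 1 => v)))
      (fun x y => fermionTorusGraph_adj_addRight _ x y) (ringAmpl t) U β)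
  rw [hE, Fintype.sum_equiv (Equiv.subRight v) (fun j => f ‖translate v t j‖) (fun j => f ‖t j‖)
    (fun j => rfl)]

/-! ### Left, right and cut bonds of the standard plane -/

section Bonds

/-- Bond `j` is a LEFT bond of the standard plane: both endpoints `j, j+1` in the left half
`{0, …, L/2 - 1}`. [cite: LiebNachtergaele1995, §3 (`t^l`)] -/
abbrev IsLeftBond (j : ZMod L) : Prop := Cut.IsLeft L (site j) ∧ Cut.IsLeft L (site (j + 1))

/-- Bond `j` is a RIGHT bond: both endpoints in the right half.
[cite: LiebNachtergaele1995, §3 (`t^r`)] -/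
abbrev IsRightBond (j : ZMod L) : Prop := ¬Cut.IsLeft L (site j) ∧ ¬Cut.IsLeft L (site (j + 1))

/-- A right bond is not a left bond. [cite: LiebNachtergaele1995, §3] -/
theorem IsRightBond.not_isLeftBond {j : ZMod L} (h : IsRightBond j) : ¬IsLeftBond j :=
  fun h' => h.1 h'.1

/-- Left bonds in coordinates: `j ∈ {0, …, L/2 - 2}`. [cite: LiebNachtergaele1995, §3 (Fig. 1)] -/
theorem isLeftBond_iff_val (h3 : 3 ≤ L) (j : ZMod L) : IsLeftBond j ↔ j.val + 2 ≤ L / 2 := by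
  rw [IsLeftBond, isLeft_site_iff, isLeft_site_iff, val_add_one (by omega)]
  have hj := ZMod.val_lt j
  rcases Nat.lt_or_ge (j.val + 1) L with h | h
  · rw [Nat.mod_eq_of_lt h]; omega
  · rw [show j.val + 1 = L by omega, Nat.mod_self]; omega

/-- Right bonds in coordinates: `j ∈ {L/2, …, L - 2}`. [cite: LiebNachtergaele1995, §3 (Fig. 1)] -/
theorem isRightBond_iff_val (h3 : 3 ≤ L) (j : ZMod L) :
    IsRightBond j ↔ L / 2 ≤ j.val ∧ j.val + 2 ≤ L := by
  rw [IsRightBond, isLeft_site_iff, isLeft_site_iff, val_add_one (by omega)]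
  have hj := ZMod.val_lt j
  rcases Nat.lt_or_ge (j.val + 1) L with h | h
  · rw [Nat.mod_eq_of_lt h]; omega
  · rw [show j.val + 1 = L by omega, Nat.mod_self]; omega

/-- The CUT bonds (neither left nor right) are `L/2 - 1` and `-1`.
[cite: LiebNachtergaele1995, §3 (`t^m = (t_L, t_{L/2})`)] -/
theorem eq_of_cut (h4 : 4 ≤ L) {j : ZMod L} (h₁ : ¬IsLeftBond j) (h₂ : ¬IsRightBond j) :
    j = ((L / 2 : ℕ) : ZMod L) - 1 ∨ j = -1 := by
  rw [isLeftBond_iff_val (by omega)] at h₁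
  rw [isRightBond_iff_val (by omega)] at h₂
  have hj := ZMod.val_lt j
  have hcases : j.val = L / 2 - 1 ∨ j.val = L - 1 := by omega
  rcases hcases with h | h
  · left
    rw [← ZMod.natCast_zmod_val j, h, Nat.cast_sub (by omega), Nat.cast_one]
  · right
    rw [← ZMod.natCast_zmod_val j, h, Nat.cast_sub (by omega), Nat.cast_one, ZMod.natCast_self,
      zero_sub]

/-- The bond `L/2 - 1` is a cut bond. [cite: LiebNachtergaele1995, §3 (`t^m`)] -/
theorem cut_half_sub_one (h4 : 4 ≤ L) :
    ¬IsLeftBond (((L / 2 : ℕ) : ZMod L) - 1) ∧ ¬IsRightBond (((L / 2 : ℕ) : ZMod L) - 1) := by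
  rw [isLeftBond_iff_val (by omega), isRightBond_iff_val (by omega), val_half_sub_one (by omega)]
  omega

/-- The bond `-1` is a cut bond. [cite: LiebNachtergaele1995, §3 (`t^m`)] -/
theorem cut_neg_one (h4 : 4 ≤ L) : ¬IsLeftBond (-1 : ZMod L) ∧ ¬IsRightBond (-1 : ZMod L) := by
  rw [isLeftBond_iff_val (by omega), isRightBond_iff_val (by omega), val_neg_one (by omega)]
  omega

/-- The set of cut bonds is `{L/2 - 1, -1}`. [cite: LiebNachtergaele1995, §3 (`t^m`)] -/
theorem filter_cut (h4 : 4 ≤ L) :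
    (univ.filter fun j : ZMod L => ¬IsLeftBond j ∧ ¬IsRightBond j) =
      {((L / 2 : ℕ) : ZMod L) - 1, -1} := by
  ext j
  simp only [mem_filter, mem_univ, true_and, mem_insert, mem_singleton]
  constructor
  · exact fun h => eq_of_cut h4 h.1 h.2
  · rintro (rfl | rfl)
    · exact cut_half_sub_one h4
    · exact cut_neg_one h4

omit [NeZero L] in
/-- The two cut bonds are distinct. [cite: LiebNachtergaele1995, §3 (`t^m`)] -/
theorem half_sub_one_ne_neg_one (h4 : 4 ≤ L) : ((L / 2 : ℕ) : ZMod L) - 1 ≠ -1 := fun h =>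
  (half_ne h4).1 (by linear_combination h)

/-- There are `L/2 - 1` right bonds. [cite: LiebNachtergaele1995, §3 (Fig. 1)] -/
theorem card_rightBonds (hL : Even L) (h4 : 4 ≤ L) :
    #(univ.filter fun j : ZMod L => IsRightBond j) = L / 2 - 1 := by
  rw [← card_image_of_injective _ (ZMod.val_injective L)]
  have h : (univ.filter fun j : ZMod L => IsRightBond j).image ZMod.val = Ico (L / 2) (L - 1) := by
    ext v
    simp only [mem_image, mem_filter, mem_univ, true_and, mem_Ico,
      isRightBond_iff_val (show 3 ≤ L by omega)]
    constructor
    · rintro ⟨j, hj, rfl⟩; omega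
    · intro hv
      refine ⟨(v : ZMod L), ?_, ?_⟩
      · rw [ZMod.val_natCast, Nat.mod_eq_of_lt (by omega)]; omega
      · rw [ZMod.val_natCast, Nat.mod_eq_of_lt (by omega)]
  rw [h, Nat.card_Ico]
  obtain ⟨k, hk⟩ := hL
  omega

/-- There are `L/2 - 1` left bonds. [cite: LiebNachtergaele1995, §3 (Fig. 1)] -/
theorem card_leftBonds (h4 : 4 ≤ L) : #(univ.filter fun j : ZMod L => IsLeftBond j) = L / 2 - 1 := by
  rw [← card_image_of_injective _ (ZMod.val_injective L)]
  have h : (univ.filter fun j : ZMod L => IsLeftBond j).image ZMod.val = range (L / 2 - 1) := by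
    ext v
    simp only [mem_image, mem_filter, mem_univ, true_and, mem_range,
      isLeftBond_iff_val (show 3 ≤ L by omega)]
    constructor
    · rintro ⟨j, hj, rfl⟩; omega
    · intro hv
      refine ⟨(v : ZMod L), ?_, ?_⟩
      · rw [ZMod.val_natCast, Nat.mod_eq_of_lt (by omega)]; omega
      · rw [ZMod.val_natCast, Nat.mod_eq_of_lt (by omega)]
  rw [h, card_range]

/-- The reflection of the bonds through the standard plane: `{j, j+1} ↦ {-j-2, -j-1}`.
[cite: LiebNachtergaele1995, §3 (Fig. 1)] -/
def bondRefl (j : ZMod L) : ZMod L := -j - 2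

omit [NeZero L] in
/-- `bondRefl` is an involution. [cite: LiebNachtergaele1995, §3] -/
theorem bondRefl_bondRefl (j : ZMod L) : bondRefl (bondRefl j) = j := by
  unfold bondRefl; ring

/-- The lower endpoint of the mirror bond is the mirror of the upper endpoint.
[cite: LiebNachtergaele1995, §3 (Fig. 1)] -/
theorem site_bondRefl (j : ZMod L) : site (bondRefl j) = Cut.reflect (site (j + 1)) := by
  rw [reflect_site, bondRefl]; congr 1; ring

/-- The upper endpoint of the mirror bond is the mirror of the lower endpoint.
[cite: LiebNachtergaele1995, §3 (Fig. 1)] -/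
theorem site_bondRefl_add_one (j : ZMod L) : site (bondRefl j + 1) = Cut.reflect (site j) := by
  rw [reflect_site, bondRefl]; congr 1; ring

/-- The mirror of a right bond is a left bond and conversely. [cite: LiebNachtergaele1995, §3] -/
theorem isLeftBond_bondRefl_iff (hL : Even L) (j : ZMod L) : IsLeftBond (bondRefl j) ↔ IsRightBond j := by
  rw [IsLeftBond, IsRightBond, site_bondRefl, site_bondRefl_add_one, Cut.isLeft_reflect_iff hL,
    Cut.isLeft_reflect_iff hL, and_comm]

/-- The mirror of a left bond is a right bond. [cite: LiebNachtergaele1995, §3] -/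
theorem isRightBond_bondRefl_iff (hL : Even L) (j : ZMod L) : IsRightBond (bondRefl j) ↔ IsLeftBond j := by
  rw [← isLeftBond_bondRefl_iff hL, bondRefl_bondRefl]

/-- A cut bond is its own mirror image. [cite: LiebNachtergaele1995, §3 (the bonds `t^m`)] -/
theorem bondRefl_eq_self_of_cut (hL : Even L) (h4 : 4 ≤ L) {j : ZMod L} (h₁ : ¬IsLeftBond j)
    (h₂ : ¬IsRightBond j) : bondRefl j = j := by
  rcases eq_of_cut h4 h₁ h₂ with h | h
  · rw [bondRefl, h]; linear_combination neg_half hL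
  · rw [bondRefl, h]; ring

end Bonds

/-! ### The reflected configurations and Lemma 3.1 at the standard plane -/

section Reflection

/-- **The reflected configuration `(t^l, t^m, θt^l)`**: left and cut bonds kept, right bonds
replaced by `-t̄` of the mirror bond (Lieb's `Θ(K_L) = -R(K_L)`).
[cite: LiebNachtergaele1995, Lemma 3.1] [cite: Lieb1994, eq. (4)] -/
def reflL (t : ZMod L → ℂ) : ZMod L → ℂ := fun j => if IsRightBond j then -star (t (bondRefl j)) else t j

/-- **The reflected configuration `(θt^r, t^m, t^r)`**.
[cite: LiebNachtergaele1995, Lemma 3.1] [cite: Lieb1994, eq. (4)] -/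
def reflR (t : ZMod L → ℂ) : ZMod L → ℂ := fun j => if IsLeftBond j then -star (t (bondRefl j)) else t j

/-- Unfolding lemma. [cite: LiebNachtergaele1995, Lemma 3.1] -/
theorem reflL_apply (t : ZMod L → ℂ) (j : ZMod L) :
    reflL t j = if IsRightBond j then -star (t (bondRefl j)) else t j := rfl

/-- Unfolding lemma. [cite: LiebNachtergaele1995, Lemma 3.1] -/
theorem reflR_apply (t : ZMod L → ℂ) (j : ZMod L) :
    reflR t j = if IsLeftBond j then -star (t (bondRefl j)) else t j := rfl

/-- `reflL` keeps the left and cut bonds. [cite: LiebNachtergaele1995, Lemma 3.1] -/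
theorem reflL_of_not_isRightBond (t : ZMod L → ℂ) {j : ZMod L} (h : ¬IsRightBond j) : reflL t j = t j := by
  rw [reflL_apply, if_neg h]

/-- `reflR` keeps the right and cut bonds. [cite: LiebNachtergaele1995, Lemma 3.1] -/
theorem reflR_of_not_isLeftBond (t : ZMod L → ℂ) {j : ZMod L} (h : ¬IsLeftBond j) : reflR t j = t j := by
  rw [reflR_apply, if_neg h]

/-- On the right and cut bonds the moduli of `reflL t` are the mirrored ones.
[cite: LiebNachtergaele1995, Lemma 3.1] -/
theorem norm_reflL_of_not_isLeftBond (hL : Even L) (h4 : 4 ≤ L) (t : ZMod L → ℂ) {j : ZMod L}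
    (h : ¬IsLeftBond j) : ‖reflL t j‖ = ‖t (bondRefl j)‖ := by
  by_cases hr : IsRightBond j
  · rw [reflL_apply, if_pos hr, norm_neg, norm_star]
  · rw [reflL_apply, if_neg hr, bondRefl_eq_self_of_cut hL h4 h hr]

/-- On the left and cut bonds the moduli of `reflR t` are the mirrored ones.
[cite: LiebNachtergaele1995, Lemma 3.1] -/
theorem norm_reflR_of_not_isRightBond (hL : Even L) (h4 : 4 ≤ L) (t : ZMod L → ℂ) {j : ZMod L}
    (h : ¬IsRightBond j) : ‖reflR t j‖ = ‖t (bondRefl j)‖ := by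
  by_cases hl : IsLeftBond j
  · rw [reflR_apply, if_pos hl, norm_neg, norm_star]
  · rw [reflR_apply, if_neg hl, bondRefl_eq_self_of_cut hL h4 hl h]

/-- The hopping amplitudes of `reflL t` are Lieb's left-symmetrised amplitudes `amplLL`.
[cite: LiebNachtergaele1995, Lemma 3.1 (proof)] [cite: Lieb1994, eq. (4)] -/
theorem ringAmpl_reflL (t : ZMod L → ℂ) : ringAmpl (reflL t) = LiebCutRP.amplLL (ringAmpl t) := by
  funext σ x y
  rw [← site_toTorusSite x, ← site_toTorusSite y]
  set a := toTorusSite x 0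
  set b := toTorusSite y 0
  rw [LiebCutRP.amplLL_apply, reflect_site, reflect_site, ringAmpl_site, ringAmpl_site, ringAmpl_site]
  have eab : (-b - 1 = -a - 1 + 1) ↔ (a = b + 1) := by
    constructor <;> intro h <;> linear_combination h
  have eba : (-a - 1 = -b - 1 + 1) ↔ (b = a + 1) := by
    constructor <;> intro h <;> linear_combination h
  simp only [eab, eba]
  by_cases h₁ : a = b + 1
  · have hm : bondRefl b = -a - 1 := by rw [bondRefl, h₁]; ring
    rw [if_pos h₁, if_pos h₁, if_pos h₁, reflL_apply, hm]
    by_cases hr : IsRightBond b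
    · have hr' : ¬Cut.IsLeft L (site a) ∧ ¬Cut.IsLeft L (site b) := ⟨h₁ ▸ hr.2, hr.1⟩
      rw [if_pos hr, if_pos hr']
    · have hr' : ¬(¬Cut.IsLeft L (site a) ∧ ¬Cut.IsLeft L (site b)) := fun h => hr ⟨h.2, h₁ ▸ h.1⟩
      rw [if_neg hr, if_neg hr']
  · rw [if_neg h₁, if_neg h₁, if_neg h₁]
    by_cases h₂ : b = a + 1
    · have hm : bondRefl a = -b - 1 := by rw [bondRefl, h₂]; ring
      rw [if_pos h₂, if_pos h₂, if_pos h₂, reflL_apply, hm]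
      by_cases hr : IsRightBond a
      · have hr' : ¬Cut.IsLeft L (site a) ∧ ¬Cut.IsLeft L (site b) := ⟨hr.1, h₂ ▸ hr.2⟩
        rw [if_pos hr, if_pos hr', star_neg, star_star]
      · have hr' : ¬(¬Cut.IsLeft L (site a) ∧ ¬Cut.IsLeft L (site b)) := fun h => hr ⟨h.1, h₂ ▸ h.2⟩
        rw [if_neg hr, if_neg hr']
    · rw [if_neg h₂, if_neg h₂, if_neg h₂]
      split_ifs <;> simp only [star_zero, neg_zero]

/-- The hopping amplitudes of `reflR t` are Lieb's right-symmetrised amplitudes `amplRR`.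
[cite: LiebNachtergaele1995, Lemma 3.1 (proof)] [cite: Lieb1994, eq. (4)] -/
theorem ringAmpl_reflR (t : ZMod L → ℂ) : ringAmpl (reflR t) = LiebCutRP.amplRR (ringAmpl t) := by
  funext σ x y
  rw [← site_toTorusSite x, ← site_toTorusSite y]
  set a := toTorusSite x 0
  set b := toTorusSite y 0
  rw [LiebCutRP.amplRR_apply, reflect_site, reflect_site, ringAmpl_site, ringAmpl_site, ringAmpl_site]
  have eab : (-b - 1 = -a - 1 + 1) ↔ (a = b + 1) := by
    constructor <;> intro h <;> linear_combination h
  have eba : (-a - 1 = -b - 1 + 1) ↔ (b = a + 1) := by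
    constructor <;> intro h <;> linear_combination h
  simp only [eab, eba]
  by_cases h₁ : a = b + 1
  · have hm : bondRefl b = -a - 1 := by rw [bondRefl, h₁]; ring
    rw [if_pos h₁, if_pos h₁, if_pos h₁, reflR_apply, hm]
    by_cases hl : IsLeftBond b
    · have hl' : Cut.IsLeft L (site a) ∧ Cut.IsLeft L (site b) := ⟨h₁ ▸ hl.2, hl.1⟩
      rw [if_pos hl, if_pos hl']
    · have hl' : ¬(Cut.IsLeft L (site a) ∧ Cut.IsLeft L (site b)) := fun h => hl ⟨h.2, h₁ ▸ h.1⟩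
      rw [if_neg hl, if_neg hl']
  · rw [if_neg h₁, if_neg h₁, if_neg h₁]
    by_cases h₂ : b = a + 1
    · have hm : bondRefl a = -b - 1 := by rw [bondRefl, h₂]; ring
      rw [if_pos h₂, if_pos h₂, if_pos h₂, reflR_apply, hm]
      by_cases hl : IsLeftBond a
      · have hl' : Cut.IsLeft L (site a) ∧ Cut.IsLeft L (site b) := ⟨hl.1, h₂ ▸ hl.2⟩
        rw [if_pos hl, if_pos hl', star_neg, star_star]
      · have hl' : ¬(Cut.IsLeft L (site a) ∧ Cut.IsLeft L (site b)) := fun h => hl ⟨h.1, h₂ ▸ h.2⟩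
        rw [if_neg hl, if_neg hl']
    · rw [if_neg h₂, if_neg h₂, if_neg h₂]
      split_ifs <;> simp only [star_zero, neg_zero]

/-- The boundary sites of the standard plane are `site (L/2 - 1)` and `site 0`.
[cite: LiebNachtergaele1995, §3 (Fig. 1)] -/
theorem isBoundary_site_iff (h4 : 4 ≤ L) (j : ZMod L) :
    Cut.IsBoundary L (site j) ↔ j = ((L / 2 : ℕ) : ZMod L) - 1 ∨ j = 0 := by
  rw [Cut.isBoundary_iff, col_site]
  have hv1 := val_half_sub_one (L := L) (by omega)
  constructor
  · rintro (h | h)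
    · left
      apply ZMod.val_injective L
      rw [hv1]; omega
    · right
      apply ZMod.val_injective L
      rw [h, ZMod.val_zero]
  · rintro (h | h)
    · left; rw [h, hv1]; omega
    · right; rw [h, ZMod.val_zero]

/-- The elastic energy is split evenly by the two reflections:
`Σ f(|reflL t|) + Σ f(|reflR t|) = 2 Σ f(|t|)`. [cite: LiebNachtergaele1995, Lemma 3.1 (proof)] -/
theorem elastic_reflL_add_reflR (hL : Even L) (f : ℝ → ℝ) (t : ZMod L → ℂ) :
    ∑ j, f ‖reflL t j‖ + ∑ j, f ‖reflR t j‖ = 2 * ∑ j, f ‖t j‖ := by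
  have hsplit : ∀ (p : ZMod L → Prop) [DecidablePred p] (s : ZMod L → ℂ), ∑ j, f ‖s j‖ =
      ∑ j ∈ univ.filter p, f ‖s j‖ + ∑ j ∈ univ.filter (fun j => ¬p j), f ‖s j‖ :=
    fun p _ s => (sum_filter_add_sum_filter_not _ _ _).symm
  have hRL : ∑ j ∈ univ.filter (fun j => IsRightBond j), f ‖reflL t j‖ =
      ∑ j ∈ univ.filter (fun j => IsLeftBond j), f ‖t j‖ := by
    refine sum_nbij' bondRefl bondRefl (fun j hj => ?_) (fun j hj => ?_)
      (fun j _ => bondRefl_bondRefl j) (fun j _ => bondRefl_bondRefl j) (fun j hj => ?_)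
    · rw [mem_filter] at hj ⊢
      exact ⟨mem_univ _, (isLeftBond_bondRefl_iff hL j).2 hj.2⟩
    · rw [mem_filter] at hj ⊢
      exact ⟨mem_univ _, (isRightBond_bondRefl_iff hL j).2 hj.2⟩
    · rw [mem_filter] at hj
      rw [reflL_apply, if_pos hj.2, norm_neg, norm_star]
  have hRn : ∑ j ∈ univ.filter (fun j => ¬IsRightBond j), f ‖reflL t j‖ =
      ∑ j ∈ univ.filter (fun j => ¬IsRightBond j), f ‖t j‖ := by
    refine sum_congr rfl fun j hj => ?_
    rw [mem_filter] at hj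
    rw [reflL_of_not_isRightBond t hj.2]
  have hLR : ∑ j ∈ univ.filter (fun j => IsLeftBond j), f ‖reflR t j‖ =
      ∑ j ∈ univ.filter (fun j => IsRightBond j), f ‖t j‖ := by
    refine sum_nbij' bondRefl bondRefl (fun j hj => ?_) (fun j hj => ?_)
      (fun j _ => bondRefl_bondRefl j) (fun j _ => bondRefl_bondRefl j) (fun j hj => ?_)
    · rw [mem_filter] at hj ⊢
      exact ⟨mem_univ _, (isRightBond_bondRefl_iff hL j).2 hj.2⟩
    · rw [mem_filter] at hj ⊢
      exact ⟨mem_univ _, (isLeftBond_bondRefl_iff hL j).2 hj.2⟩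
    · rw [mem_filter] at hj
      rw [reflR_apply, if_pos hj.2, norm_neg, norm_star]
  have hLn : ∑ j ∈ univ.filter (fun j => ¬IsLeftBond j), f ‖reflR t j‖ =
      ∑ j ∈ univ.filter (fun j => ¬IsLeftBond j), f ‖t j‖ := by
    refine sum_congr rfl fun j hj => ?_
    rw [mem_filter] at hj
    rw [reflR_of_not_isLeftBond t hj.2]
  have e1 := hsplit (fun j => IsRightBond j) (reflL t)
  have e2 := hsplit (fun j => IsLeftBond j) (reflR t)
  have e3 := hsplit (fun j => IsRightBond j) t
  have e4 := hsplit (fun j => IsLeftBond j) t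
  rw [hRL, hRn] at e1
  rw [hLR, hLn] at e2
  linarith

/-- **Lemma 3.1 (`RPineq`) at the standard plane.** If the two cut bonds `t_{L/2-1}` and `t_{-1}`
are real and nonnegative, then `𝓔_L(reflL t) + 𝓔_L(reflR t) ≤ 2 𝓔_L(t)` — the electronic part is
Lieb's reflection positivity on the ring (`LiebCutRP.groundEnergy_add_le_two_mul`), the elastic
terms add up to the same on both sides. This is the printed `RPineq` in Lieb's gauge: here the
reflected half carries `-t̄` and both cut bonds are `≥ 0`, whereas the paper takes the plain
conjugate reflection `θ` with `t_{L/2}, t_L ≥ 0` for `L ≡ 2 (mod 4)` and `t_{L/2} ≥ 0 ≥ t_L` for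
`L ≡ 0 (mod 4)`; the two forms are gauge equivalent (the reflected ring has flux `(-1)^{L/2-1}`
in both, `hasCanonicalFlux_reflL`, `energy_gauge`).
[cite: LiebNachtergaele1995, Lemma 3.1] [cite: Lieb1994, Lemma] -/
theorem energy_reflL_add_energy_reflR_le (hL : Even L) (h4 : 4 ≤ L) (f : ℝ → ℝ) (U : ℝ)
    {t : ZMod L → ℂ} {r₁ r₂ : ℝ} (hr₁ : 0 ≤ r₁) (hr₂ : 0 ≤ r₂)
    (ht₁ : t (((L / 2 : ℕ) : ZMod L) - 1) = r₁) (ht₂ : t (-1) = r₂) :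
    energy f U (reflL t) + energy f U (reflR t) ≤ 2 * energy f U t := by
  have h3 : 3 ≤ L := by omega
  set tc : Fin 2 → FermionTorus 1 L → ℝ := fun _ x => if Cut.col x = 0 then r₂ else r₁ with htc_def
  have htc : ∀ σ (x : FermionTorus 1 L), Cut.IsBoundary L x → 0 ≤ tc σ x := fun σ x _ => by
    simp only [htc_def]; split_ifs <;> assumption
  have hv1 : (((L / 2 : ℕ) : ZMod L) - 1).val ≠ 0 := by rw [val_half_sub_one (by omega)]; omega
  have hcut : ∀ σ (x : FermionTorus 1 L), Cut.IsBoundary L x → ringAmpl t σ x (Cut.reflect x) = tc σ x := by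
    intro σ x hx
    rw [← site_toTorusSite x] at hx ⊢
    set a := toTorusSite x 0
    rw [reflect_site, ringAmpl_site]
    simp only [htc_def, col_site]
    rcases (isBoundary_site_iff h4 a).1 hx with ha | ha
    · have hm : -a - 1 = a + 1 := by rw [ha]; linear_combination neg_half (L := L) hL
      rw [if_neg (fun h => not_both_succ h3 hm h), if_pos hm, ha, ht₁, Complex.star_def,
        Complex.conj_ofReal, if_neg hv1]
    · have hm : a = -a - 1 + 1 := by rw [ha]; ring
      rw [if_pos hm, ha, if_pos (ZMod.val_zero : (0 : ZMod L).val = 0), neg_zero, zero_sub, ht₂]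
  have hel : (hamiltonian U (reflL t)).groundEnergy + (hamiltonian U (reflR t)).groundEnergy ≤
      2 * (hamiltonian U t).groundEnergy := by
    have h := LiebCutRP.groundEnergy_add_le_two_mul (d := 0) hL h4 htc U (ringAmpl t)
      (ringAmpl_herm h3 t) hcut
    rw [← ringAmpl_reflL, ← ringAmpl_reflR] at h
    exact h
  have helastic := elastic_reflL_add_reflR hL f t
  unfold energy
  linarith

end Reflection

/-! ### The planes through the other bonds (translation), and the two-site gauge -/

section Planes

/-- **The left-symmetrised configuration for the plane translated by `a`** (cut bonds `a - 1` and
`a + L/2 - 1`): translate back, reflect, translate.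
[cite: LiebNachtergaele1995, §3 ("the argument can be repeated")] -/
def reflLAt (a : ZMod L) (t : ZMod L → ℂ) : ZMod L → ℂ := translate a (reflL (translate (-a) t))

/-- **The right-symmetrised configuration for the plane translated by `a`.**
[cite: LiebNachtergaele1995, §3] -/
def reflRAt (a : ZMod L) (t : ZMod L → ℂ) : ZMod L → ℂ := translate a (reflR (translate (-a) t))

/-- **Lemma 3.1 at every plane**: if the cut bonds `t_{a + L/2 - 1}`, `t_{a - 1}` are real and
nonnegative then `𝓔_L(reflLAt a t) + 𝓔_L(reflRAt a t) ≤ 2 𝓔_L(t)`.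
[cite: LiebNachtergaele1995, Lemma 3.1 and §3] -/
theorem energy_reflLAt_add_energy_reflRAt_le (hL : Even L) (h4 : 4 ≤ L) (f : ℝ → ℝ) (U : ℝ)
    (a : ZMod L) {t : ZMod L → ℂ} {r₁ r₂ : ℝ} (hr₁ : 0 ≤ r₁) (hr₂ : 0 ≤ r₂)
    (ht₁ : t (a + ((L / 2 : ℕ) : ZMod L) - 1) = r₁) (ht₂ : t (a - 1) = r₂) :
    energy f U (reflLAt a t) + energy f U (reflRAt a t) ≤ 2 * energy f U t := by
  have h3 : 3 ≤ L := by omega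
  have h := energy_reflL_add_energy_reflR_le hL h4 f U (t := translate (-a) t) hr₁ hr₂
    (by rw [translate_apply, ← ht₁]; congr 1; ring) (by rw [translate_apply, ← ht₂]; congr 1; ring)
  rw [energy_translate h3] at h
  unfold reflLAt reflRAt
  rwa [energy_translate h3, energy_translate h3]

/-- The unit phase of a complex number (`1` at `0`).
[cite: LiebNachtergaele1995, §1 (`t_j = |t_j| e^{iθ_j}`)] -/
def phase (z : ℂ) : ℂ := if z = 0 then 1 else z / (‖z‖ : ℂ)

/-- `|phase z| = 1`. [cite: LiebNachtergaele1995, §1] -/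
theorem norm_phase (z : ℂ) : ‖phase z‖ = 1 := by
  unfold phase
  split_ifs with h
  · exact norm_one
  · rw [norm_div, Complex.norm_real, norm_norm, div_self (norm_ne_zero_iff.2 h)]

/-- `conj(phase z) · z = |z|`. [cite: LiebNachtergaele1995, §1] -/
theorem star_phase_mul (z : ℂ) : star (phase z) * z = (‖z‖ : ℂ) := by
  unfold phase
  split_ifs with h
  · rw [h, mul_zero, norm_zero, Complex.ofReal_zero]
  · have hz : (‖z‖ : ℂ) ≠ 0 := Complex.ofReal_ne_zero.2 (norm_ne_zero_iff.2 h)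
    rw [Complex.star_def, map_div₀, Complex.conj_ofReal, div_mul_eq_mul_div, Complex.conj_mul', sq,
      mul_div_assoc, div_self hz, mul_one]

/-- **The two-site gauge** fixing the cut bonds of the plane `a`: phase `conj(phase t_{a-1})` at
site `a`, `conj(phase t_{a+L/2-1})` at site `a + L/2`, `1` elsewhere.
[cite: LiebNachtergaele1995, §3 (proof of Thm 1: "`t'_{L/2}` and `t'_L` are real and have the correct sign")] -/
def cutGauge (a : ZMod L) (t : ZMod L → ℂ) : ZMod L → ℂ := fun x =>
  if x = a then star (phase (t (a - 1)))
  else if x = a + ((L / 2 : ℕ) : ZMod L) then star (phase (t (a + ((L / 2 : ℕ) : ZMod L) - 1)))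
  else 1

omit [NeZero L] in
/-- Unfolding lemma. [cite: LiebNachtergaele1995, §3] -/
theorem cutGauge_apply (a : ZMod L) (t : ZMod L → ℂ) (x : ZMod L) :
    cutGauge a t x = if x = a then star (phase (t (a - 1)))
      else if x = a + ((L / 2 : ℕ) : ZMod L) then star (phase (t (a + ((L / 2 : ℕ) : ZMod L) - 1)))
      else 1 := rfl

omit [NeZero L] in
/-- The two-site gauge consists of phases. [cite: LiebNachtergaele1995, §3] -/
theorem norm_cutGauge (a : ZMod L) (t : ZMod L → ℂ) (x : ZMod L) : ‖cutGauge a t x‖ = 1 := by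
  rw [cutGauge_apply]
  split_ifs
  · rw [norm_star, norm_phase]
  · rw [norm_star, norm_phase]
  · exact norm_one

omit [NeZero L] in
/-- Unfolding lemma for the gauged amplitudes. [cite: LiebNachtergaele1995, §1] -/
theorem gauge_apply (g t : ZMod L → ℂ) (j : ZMod L) : gauge g t j = g (j + 1) * star (g j) * t j := rfl

omit [NeZero L] in
/-- **The gauge-fixed configuration has real nonnegative cut bonds** `|t_{a-1}|` and
`|t_{a+L/2-1}|`. [cite: LiebNachtergaele1995, §3 (proof of Thm 1)] -/
theorem gauge_cutGauge_cut (h4 : 4 ≤ L) (a : ZMod L) (t : ZMod L → ℂ) :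
    gauge (cutGauge a t) t (a - 1) = (‖t (a - 1)‖ : ℂ) ∧
      gauge (cutGauge a t) t (a + ((L / 2 : ℕ) : ZMod L) - 1) =
        (‖t (a + ((L / 2 : ℕ) : ZMod L) - 1)‖ : ℂ) := by
  obtain ⟨hne0, hne1, hne1'⟩ := half_ne (L := L) h4
  have h1 : (1 : ZMod L) ≠ 0 := by haveI : Fact (1 < L) := ⟨by omega⟩; exact one_ne_zero
  constructor
  · have e1 : a - 1 ≠ a := fun h => h1 (by linear_combination -h)
    have e2 : a - 1 ≠ a + ((L / 2 : ℕ) : ZMod L) := fun h => hne1' (by linear_combination -h)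
    rw [gauge_apply, sub_add_cancel, cutGauge_apply, if_pos rfl, cutGauge_apply, if_neg e1, if_neg e2,
      star_one, mul_one, star_phase_mul]
  · have e1 : a + ((L / 2 : ℕ) : ZMod L) ≠ a := fun h => hne0 (by linear_combination h)
    have e2 : a + ((L / 2 : ℕ) : ZMod L) - 1 ≠ a := fun h => hne1 (by linear_combination h)
    have e3 : a + ((L / 2 : ℕ) : ZMod L) - 1 ≠ a + ((L / 2 : ℕ) : ZMod L) := fun h =>
      h1 (by linear_combination -h)
    rw [gauge_apply, sub_add_cancel, cutGauge_apply, if_neg e1, if_pos rfl, cutGauge_apply, if_neg e2,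
      if_neg e3, star_one, mul_one, star_phase_mul]

/-- A gauge transform of a minimiser is a minimiser. [cite: LiebNachtergaele1995, §1] -/
theorem IsMinimizer.gauge (h3 : 3 ≤ L) {f : ℝ → ℝ} {U : ℝ} {t : ZMod L → ℂ} (h : IsMinimizer f U t)
    {g : ZMod L → ℂ} (hg : ∀ j, ‖g j‖ = 1) : IsMinimizer f U (gauge g t) := fun s => by
  rw [energy_gauge h3 hg]; exact h s

/-- A translate of a minimiser is a minimiser. [cite: LiebNachtergaele1995, §3] -/
theorem IsMinimizer.translate (h3 : 3 ≤ L) {f : ℝ → ℝ} {U : ℝ} {t : ZMod L → ℂ}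
    (h : IsMinimizer f U t) (v : ZMod L) : IsMinimizer f U (translate v t) := fun s => by
  rw [energy_translate h3]; exact h s

/-- If `𝓔(t₁) + 𝓔(t₂) ≤ 2𝓔(t)` for a minimiser `t` then `t₁` and `t₂` are minimisers.
[cite: LiebNachtergaele1995, §3 (proof of Thm 1: "and also be minimizing")] -/
theorem IsMinimizer.of_add_le {f : ℝ → ℝ} {U : ℝ} {t t₁ t₂ : ZMod L → ℂ} (h : IsMinimizer f U t)
    (hle : energy f U t₁ + energy f U t₂ ≤ 2 * energy f U t) :
    IsMinimizer f U t₁ ∧ IsMinimizer f U t₂ := by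
  have h₁ := h t₁
  have h₂ := h t₂
  exact ⟨fun s => by linarith [h s], fun s => by linarith [h s]⟩

end Planes

/-! ### The flux of the reflected configurations -/

section Flux

/-- **Canonical flux**: `Π_j t_j = (-1)^{L/2 - 1} r` with `r ≥ 0`, i.e. flux `0` for
`L ≡ 2 (mod 4)` and flux `π` for `L ≡ 0 (mod 4)` (we write the sign as `(-1)^{L/2+1}`).
[cite: LiebNachtergaele1995, Theorem 1 and §3] [cite: Lieb1994, Theorem] -/
def HasCanonicalFlux (t : ZMod L → ℂ) : Prop := ∃ r : ℝ, 0 ≤ r ∧ bondProd t = (-1) ^ (L / 2 + 1) * r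

/-- The flux is translation invariant. [cite: LiebNachtergaele1995, §3] -/
theorem bondProd_translate (v : ZMod L) (t : ZMod L → ℂ) : bondProd (translate v t) = bondProd t :=
  Fintype.prod_equiv (Equiv.subRight v) _ _ fun _ => rfl

/-- The product over all bonds of a half-reflected configuration: `(-1)^{#P} · conj(Π_Q t) · Π_Q t ·
Π_cut t` when the bonds in `P` carry `-conj` of their mirrors in `Q`.
[cite: LiebNachtergaele1995, §3 (proof of Thm 1, "correct sign for the flux")] -/
theorem bondProd_halfRefl (P Q : ZMod L → Prop) [DecidablePred P] [DecidablePred Q]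
    (hPQ : ∀ j, P j → Q (bondRefl j)) (hQP : ∀ j, Q j → P (bondRefl j)) (hdisj : ∀ j, Q j → ¬P j)
    (s t : ZMod L → ℂ) (hs₁ : ∀ j, P j → s j = -star (t (bondRefl j))) (hs₂ : ∀ j, ¬P j → s j = t j) :
    bondProd s = (-1) ^ #(univ.filter P) * star (∏ j ∈ univ.filter Q, t j) *
      (∏ j ∈ univ.filter Q, t j) * ∏ j ∈ univ.filter (fun j => ¬P j ∧ ¬Q j), t j := by
  unfold bondProd
  rw [← prod_filter_mul_prod_filter_not univ P]
  have h1 : ∏ j ∈ univ.filter P, s j = (-1) ^ #(univ.filter P) * star (∏ j ∈ univ.filter Q, t j) := by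
    rw [star_prod, prod_congr rfl (fun j hj => hs₁ j (mem_filter.1 hj).2)]
    simp_rw [neg_eq_neg_one_mul (star _)]
    rw [prod_mul_distrib, prod_const]
    congr 1
    refine prod_nbij' bondRefl bondRefl (fun j hj => ?_) (fun j hj => ?_)
      (fun j _ => bondRefl_bondRefl j) (fun j _ => bondRefl_bondRefl j) (fun j _ => rfl)
    · rw [mem_filter] at hj ⊢
      exact ⟨mem_univ _, hPQ j hj.2⟩
    · rw [mem_filter] at hj ⊢
      exact ⟨mem_univ _, hQP j hj.2⟩
  have h2 : ∏ j ∈ univ.filter (fun j => ¬P j), s j =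
      (∏ j ∈ univ.filter Q, t j) * ∏ j ∈ univ.filter (fun j => ¬P j ∧ ¬Q j), t j := by
    rw [prod_congr rfl (fun j hj => hs₂ j (mem_filter.1 hj).2),
      ← prod_filter_mul_prod_filter_not (univ.filter fun j => ¬P j) Q, filter_filter, filter_filter]
    congr 1
    refine prod_congr (filter_congr fun j _ => ⟨fun h => h.2, fun h => ⟨hdisj j h, h⟩⟩) fun _ _ => rfl
  rw [h1, h2]
  ring

/-- **The flux of `reflL t` is canonical** when the cut bonds are real and nonnegative:
`Π_j (reflL t)_j = (-1)^{L/2-1} |Π_left t_j|² t_{L/2-1} t_{-1}`.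
[cite: LiebNachtergaele1995, §3 (proof of Thm 1)] [cite: Lieb1994, Theorem] -/
theorem hasCanonicalFlux_reflL (hL : Even L) (h4 : 4 ≤ L) {t : ZMod L → ℂ} {r₁ r₂ : ℝ}
    (hr₁ : 0 ≤ r₁) (hr₂ : 0 ≤ r₂) (ht₁ : t (((L / 2 : ℕ) : ZMod L) - 1) = r₁) (ht₂ : t (-1) = r₂) :
    HasCanonicalFlux (reflL t) := by
  have h := bondProd_halfRefl (fun j => IsRightBond j) (fun j => IsLeftBond j)
    (fun j hj => (isLeftBond_bondRefl_iff hL j).2 hj) (fun j hj => (isRightBond_bondRefl_iff hL j).2 hj)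
    (fun j hj hr => hr.not_isLeftBond hj) (reflL t) t (fun j hj => by rw [reflL_apply, if_pos hj])
    (fun j hj => reflL_of_not_isRightBond t hj)
  have hcut : ∏ j ∈ univ.filter (fun j => ¬IsRightBond j ∧ ¬IsLeftBond j), t j = r₁ * r₂ := by
    rw [filter_congr (fun j _ => (and_comm : ¬IsRightBond j ∧ ¬IsLeftBond j ↔ _)), filter_cut h4,
      prod_pair (half_sub_one_ne_neg_one h4), ht₁, ht₂]
  set PL := ∏ j ∈ univ.filter (fun j => IsLeftBond j), t j
  refine ⟨‖PL‖ ^ 2 * (r₁ * r₂), by positivity, ?_⟩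
  have hpow : ((-1 : ℂ)) ^ (L / 2 - 1) = (-1) ^ (L / 2 + 1) := by
    rw [show L / 2 + 1 = (L / 2 - 1) + 2 by omega, pow_add, neg_one_sq, mul_one]
  have hsq : star PL * PL = ((‖PL‖ ^ 2 : ℝ) : ℂ) := by
    rw [Complex.star_def, Complex.conj_mul']; push_cast; ring
  rw [h, hcut, card_rightBonds hL h4, hpow, mul_assoc ((-1 : ℂ) ^ (L / 2 + 1)) (star PL) PL, hsq]
  push_cast
  ring

/-- **The flux of `reflR t` is canonical** when the cut bonds are real and nonnegative.
[cite: LiebNachtergaele1995, §3 (proof of Thm 1)] [cite: Lieb1994, Theorem] -/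
theorem hasCanonicalFlux_reflR (hL : Even L) (h4 : 4 ≤ L) {t : ZMod L → ℂ} {r₁ r₂ : ℝ}
    (hr₁ : 0 ≤ r₁) (hr₂ : 0 ≤ r₂) (ht₁ : t (((L / 2 : ℕ) : ZMod L) - 1) = r₁) (ht₂ : t (-1) = r₂) :
    HasCanonicalFlux (reflR t) := by
  have h := bondProd_halfRefl (fun j => IsLeftBond j) (fun j => IsRightBond j)
    (fun j hj => (isRightBond_bondRefl_iff hL j).2 hj) (fun j hj => (isLeftBond_bondRefl_iff hL j).2 hj)
    (fun j hj => hj.not_isLeftBond) (reflR t) t (fun j hj => by rw [reflR_apply, if_pos hj])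
    (fun j hj => reflR_of_not_isLeftBond t hj)
  have hcut : ∏ j ∈ univ.filter (fun j => ¬IsLeftBond j ∧ ¬IsRightBond j), t j = r₁ * r₂ := by
    rw [filter_cut h4, prod_pair (half_sub_one_ne_neg_one h4), ht₁, ht₂]
  set PR := ∏ j ∈ univ.filter (fun j => IsRightBond j), t j
  refine ⟨‖PR‖ ^ 2 * (r₁ * r₂), by positivity, ?_⟩
  have hpow : ((-1 : ℂ)) ^ (L / 2 - 1) = (-1) ^ (L / 2 + 1) := by
    rw [show L / 2 + 1 = (L / 2 - 1) + 2 by omega, pow_add, neg_one_sq, mul_one]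
  have hsq : star PR * PR = ((‖PR‖ ^ 2 : ℝ) : ℂ) := by
    rw [Complex.star_def, Complex.conj_mul']; push_cast; ring
  rw [h, hcut, card_leftBonds h4, hpow, mul_assoc ((-1 : ℂ) ^ (L / 2 + 1)) (star PR) PR, hsq]
  push_cast
  ring

/-- The flux of `reflLAt a t` is canonical when the cut bonds of the plane `a` are real and
nonnegative. [cite: LiebNachtergaele1995, §3 (proof of Thm 1)] -/
theorem hasCanonicalFlux_reflLAt (hL : Even L) (h4 : 4 ≤ L) (a : ZMod L) {t : ZMod L → ℂ}
    {r₁ r₂ : ℝ} (hr₁ : 0 ≤ r₁) (hr₂ : 0 ≤ r₂) (ht₁ : t (a + ((L / 2 : ℕ) : ZMod L) - 1) = r₁)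
    (ht₂ : t (a - 1) = r₂) : HasCanonicalFlux (reflLAt a t) := by
  obtain ⟨r, hr, h⟩ := hasCanonicalFlux_reflL hL h4 (t := translate (-a) t) hr₁ hr₂
    (by rw [translate_apply, ← ht₁]; congr 1; ring) (by rw [translate_apply, ← ht₂]; congr 1; ring)
  exact ⟨r, hr, by rw [reflLAt, bondProd_translate, h]⟩

/-- The flux of `reflRAt a t` is canonical when the cut bonds of the plane `a` are real and
nonnegative. [cite: LiebNachtergaele1995, §3 (proof of Thm 1)] -/
theorem hasCanonicalFlux_reflRAt (hL : Even L) (h4 : 4 ≤ L) (a : ZMod L) {t : ZMod L → ℂ}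
    {r₁ r₂ : ℝ} (hr₁ : 0 ≤ r₁) (hr₂ : 0 ≤ r₂) (ht₁ : t (a + ((L / 2 : ℕ) : ZMod L) - 1) = r₁)
    (ht₂ : t (a - 1) = r₂) : HasCanonicalFlux (reflRAt a t) := by
  obtain ⟨r, hr, h⟩ := hasCanonicalFlux_reflR hL h4 (t := translate (-a) t) hr₁ hr₂
    (by rw [translate_apply, ← ht₁]; congr 1; ring) (by rw [translate_apply, ← ht₂]; congr 1; ring)
  exact ⟨r, hr, by rw [reflRAt, bondProd_translate, h]⟩

end Flux

/-! ### Counting pairs of identical moduli `|t_{j+2}| = |t_j|` -/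

section Pairs

/-- The indicator of the pair `(j, j+2)` having identical moduli.
[cite: LiebNachtergaele1995, §3 (proof of Thm 1: "pairs of identical `|t_j|`'s")] -/
def pairInd (t : ZMod L → ℂ) (j : ZMod L) : ℕ := if ‖t (j + 2)‖ = ‖t j‖ then 1 else 0

/-- **The number of pairs `(j, j+2)` of identical moduli.**
[cite: LiebNachtergaele1995, §3 (proof of Thm 1)] -/
def pairCount (t : ZMod L → ℂ) : ℕ := #(univ.filter fun j : ZMod L => ‖t (j + 2)‖ = ‖t j‖)

/-- `pairCount` as a sum of indicators. [cite: LiebNachtergaele1995, §3] -/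
theorem pairCount_eq_sum (t : ZMod L → ℂ) : pairCount t = ∑ j, pairInd t j := card_filter _ _

omit [NeZero L] in
/-- `pairInd ≤ 1`. [cite: LiebNachtergaele1995, §3] -/
theorem pairInd_le_one (t : ZMod L → ℂ) (j : ZMod L) : pairInd t j ≤ 1 := by
  unfold pairInd; split_ifs <;> omega

/-- `pairCount ≤ L`. [cite: LiebNachtergaele1995, §3] -/
theorem pairCount_le (t : ZMod L → ℂ) : pairCount t ≤ L := by
  unfold pairCount
  exact (card_filter_le _ _).trans (by rw [card_univ, ZMod.card])

/-- All pairs are identical iff `pairCount = L`. [cite: LiebNachtergaele1995, §3] -/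
theorem forall_norm_eq_of_le_pairCount {t : ZMod L → ℂ} (h : L ≤ pairCount t) (j : ZMod L) :
    ‖t (j + 2)‖ = ‖t j‖ := by
  have hc : #(univ.filter fun j : ZMod L => ‖t (j + 2)‖ = ‖t j‖) = #(univ : Finset (ZMod L)) :=
    le_antisymm (card_filter_le _ _) (by rw [card_univ, ZMod.card]; exact h)
  exact (card_filter_eq_iff.1 hc) j (mem_univ j)

/-- The pair count only depends on the moduli. [cite: LiebNachtergaele1995, §3] -/
theorem pairCount_congr {s t : ZMod L → ℂ} (h : ∀ j, ‖s j‖ = ‖t j‖) : pairCount s = pairCount t := by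
  unfold pairCount
  simp_rw [h]

/-- The pair count is translation invariant. [cite: LiebNachtergaele1995, §3] -/
theorem pairCount_translate (v : ZMod L) (t : ZMod L → ℂ) : pairCount (translate v t) = pairCount t := by
  rw [pairCount_eq_sum, pairCount_eq_sum]
  refine Fintype.sum_equiv (Equiv.subRight v) _ _ fun j => ?_
  simp only [pairInd, translate_apply, Equiv.subRight_apply, add_sub_right_comm]

/-- The reflection of the PAIRS through the standard plane: `(j, j+2) ↦ (-j-4, -j-2)`.
[cite: LiebNachtergaele1995, §3 (Fig. 1)] -/
def pairRefl (j : ZMod L) : ZMod L := -j - 4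

omit [NeZero L] in
/-- `pairRefl` is an involution. [cite: LiebNachtergaele1995, §3] -/
theorem pairRefl_pairRefl (j : ZMod L) : pairRefl (pairRefl j) = j := by unfold pairRefl; ring

omit [NeZero L] in
/-- The middle bond of the mirrored pair is the mirror of the middle bond. [cite: LiebNachtergaele1995, §3] -/
theorem pairRefl_add_one (j : ZMod L) : pairRefl j + 1 = bondRefl (j + 1) := by
  unfold pairRefl bondRefl; ring

omit [NeZero L] in
/-- `bondRefl (j + 2) = pairRefl j`. [cite: LiebNachtergaele1995, §3] -/
theorem bondRefl_add_two (j : ZMod L) : bondRefl (j + 2) = pairRefl j := by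
  unfold pairRefl bondRefl; ring

omit [NeZero L] in
/-- `bondRefl j = pairRefl j + 2`. [cite: LiebNachtergaele1995, §3] -/
theorem bondRefl_eq_pairRefl_add_two (j : ZMod L) : bondRefl j = pairRefl j + 2 := by
  unfold pairRefl bondRefl; ring

/-- `site (j + 1 + 1) = site (j + 2)`. [cite: LiebNachtergaele1995, §1] -/
theorem site_add_one_add_one (j : ZMod L) : site (j + 1 + 1) = site (j + 2) := by
  rw [add_assoc, one_add_one_eq_two]

/-- A pair whose middle bond is a left bond has no right bond. [cite: LiebNachtergaele1995, §3] -/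
theorem not_isRightBond_of_mid_left {j : ZMod L} (h : IsLeftBond (j + 1)) :
    ¬IsRightBond j ∧ ¬IsRightBond (j + 2) :=
  ⟨fun hr => hr.2 h.1, fun hr => hr.1 (by rw [← site_add_one_add_one]; exact h.2)⟩

/-- A pair whose middle bond is a right bond has no left bond. [cite: LiebNachtergaele1995, §3] -/
theorem not_isLeftBond_of_mid_right {j : ZMod L} (h : IsRightBond (j + 1)) :
    ¬IsLeftBond j ∧ ¬IsLeftBond (j + 2) :=
  ⟨fun hl => h.1 hl.2, fun hl => h.2 (by rw [site_add_one_add_one]; exact hl.1)⟩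

/-- A pair whose middle bond is a cut bond consists of a bond and its mirror image.
[cite: LiebNachtergaele1995, §3] -/
theorem bondRefl_eq_add_two_of_mid_cut (hL : Even L) (h4 : 4 ≤ L) {j : ZMod L}
    (h₁ : ¬IsLeftBond (j + 1)) (h₂ : ¬IsRightBond (j + 1)) : bondRefl j = j + 2 := by
  rcases eq_of_cut h4 h₁ h₂ with h | h
  · rw [bondRefl]; linear_combination (-2 : ZMod L) * h + neg_half hL
  · rw [bondRefl]; linear_combination (-2 : ZMod L) * h

/-- Two consecutive bonds are not both cut bonds (`L ≥ 4`). [cite: LiebNachtergaele1995, §3] -/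
theorem left_or_right_of_mid_cut (h4 : 4 ≤ L) {j : ZMod L} (h₁ : ¬IsLeftBond (j + 1))
    (h₂ : ¬IsRightBond (j + 1)) : IsLeftBond j ∨ IsRightBond j := by
  by_contra hj
  rw [not_or] at hj
  obtain ⟨hne0, hne1, hne1'⟩ := half_ne (L := L) h4
  have h1 : (1 : ZMod L) ≠ 0 := by haveI : Fact (1 < L) := ⟨by omega⟩; exact one_ne_zero
  rcases eq_of_cut h4 hj.1 hj.2 with h | h <;> rcases eq_of_cut h4 h₁ h₂ with h' | h'
  · exact h1 (by linear_combination h' - h)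
  · exact hne1' (by linear_combination h' - h)
  · exact hne1 (by linear_combination h - h')
  · exact h1 (by linear_combination h' - h)

/-- The three classes of pairs by their middle bond. [cite: LiebNachtergaele1995, §3] -/
theorem sum_pairs_split (g : ZMod L → ℕ) :
    ∑ j, g j = ∑ j ∈ univ.filter (fun j => IsLeftBond (j + 1)), g j +
      ∑ j ∈ univ.filter (fun j => IsRightBond (j + 1)), g j +
      ∑ j ∈ univ.filter (fun j => ¬IsLeftBond (j + 1) ∧ ¬IsRightBond (j + 1)), g j := by
  rw [← sum_filter_add_sum_filter_not univ (fun j => IsLeftBond (j + 1)) g, add_assoc,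
    ← sum_filter_add_sum_filter_not (univ.filter fun j => ¬IsLeftBond (j + 1))
      (fun j => IsRightBond (j + 1)) g, filter_filter, filter_filter]
  congr 2
  exact sum_congr (filter_congr fun j _ => ⟨fun h => h.2, fun h => ⟨h.not_isLeftBond, h⟩⟩) fun _ _ => rfl

/-- Mirroring the pairs exchanges the left-middle and right-middle classes.
[cite: LiebNachtergaele1995, §3] -/
theorem sum_pairRefl_right_eq_left (hL : Even L) (g : ZMod L → ℕ) :
    ∑ j ∈ univ.filter (fun j => IsRightBond (j + 1)), g (pairRefl j) =
      ∑ j ∈ univ.filter (fun j => IsLeftBond (j + 1)), g j := by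
  refine sum_nbij' pairRefl pairRefl (fun j hj => ?_) (fun j hj => ?_) (fun j _ => pairRefl_pairRefl j)
    (fun j _ => pairRefl_pairRefl j) (fun _ _ => rfl)
  · rw [mem_filter] at hj ⊢
    exact ⟨mem_univ _, by rw [pairRefl_add_one]; exact (isLeftBond_bondRefl_iff hL _).2 hj.2⟩
  · rw [mem_filter] at hj ⊢
    exact ⟨mem_univ _, by rw [pairRefl_add_one]; exact (isRightBond_bondRefl_iff hL _).2 hj.2⟩

/-- Mirroring the pairs exchanges the right-middle and left-middle classes.
[cite: LiebNachtergaele1995, §3] -/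
theorem sum_pairRefl_left_eq_right (hL : Even L) (g : ZMod L → ℕ) :
    ∑ j ∈ univ.filter (fun j => IsLeftBond (j + 1)), g (pairRefl j) =
      ∑ j ∈ univ.filter (fun j => IsRightBond (j + 1)), g j := by
  refine sum_nbij' pairRefl pairRefl (fun j hj => ?_) (fun j hj => ?_) (fun j _ => pairRefl_pairRefl j)
    (fun j _ => pairRefl_pairRefl j) (fun _ _ => rfl)
  · rw [mem_filter] at hj ⊢
    exact ⟨mem_univ _, by rw [pairRefl_add_one]; exact (isRightBond_bondRefl_iff hL _).2 hj.2⟩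
  · rw [mem_filter] at hj ⊢
    exact ⟨mem_univ _, by rw [pairRefl_add_one]; exact (isLeftBond_bondRefl_iff hL _).2 hj.2⟩

/-- Pairs with a left middle bond are untouched by `reflL`. [cite: LiebNachtergaele1995, §3] -/
theorem pairInd_reflL_of_mid_left (t : ZMod L → ℂ) {j : ZMod L} (h : IsLeftBond (j + 1)) :
    pairInd (reflL t) j = pairInd t j := by
  obtain ⟨h0, h2⟩ := not_isRightBond_of_mid_left h
  rw [pairInd, pairInd, reflL_of_not_isRightBond t h0, reflL_of_not_isRightBond t h2]

/-- Pairs with a right middle bond are untouched by `reflR`. [cite: LiebNachtergaele1995, §3] -/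
theorem pairInd_reflR_of_mid_right (t : ZMod L → ℂ) {j : ZMod L} (h : IsRightBond (j + 1)) :
    pairInd (reflR t) j = pairInd t j := by
  obtain ⟨h0, h2⟩ := not_isLeftBond_of_mid_right h
  rw [pairInd, pairInd, reflR_of_not_isLeftBond t h0, reflR_of_not_isLeftBond t h2]

/-- Pairs with a right middle bond see the mirrored pair under `reflL`. [cite: LiebNachtergaele1995, §3] -/
theorem pairInd_reflL_of_mid_right (hL : Even L) (h4 : 4 ≤ L) (t : ZMod L → ℂ) {j : ZMod L}
    (h : IsRightBond (j + 1)) : pairInd (reflL t) j = pairInd t (pairRefl j) := by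
  obtain ⟨h0, h2⟩ := not_isLeftBond_of_mid_right h
  rw [pairInd, pairInd, norm_reflL_of_not_isLeftBond hL h4 t h0, norm_reflL_of_not_isLeftBond hL h4 t h2,
    bondRefl_add_two, bondRefl_eq_pairRefl_add_two]
  exact if_congr eq_comm rfl rfl

/-- Pairs with a left middle bond see the mirrored pair under `reflR`. [cite: LiebNachtergaele1995, §3] -/
theorem pairInd_reflR_of_mid_left (hL : Even L) (h4 : 4 ≤ L) (t : ZMod L → ℂ) {j : ZMod L}
    (h : IsLeftBond (j + 1)) : pairInd (reflR t) j = pairInd t (pairRefl j) := by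
  obtain ⟨h0, h2⟩ := not_isRightBond_of_mid_left h
  rw [pairInd, pairInd, norm_reflR_of_not_isRightBond hL h4 t h0,
    norm_reflR_of_not_isRightBond hL h4 t h2, bondRefl_add_two, bondRefl_eq_pairRefl_add_two]
  exact if_congr eq_comm rfl rfl

/-- **A pair straddling the plane becomes a pair of identical moduli** under `reflL`.
[cite: LiebNachtergaele1995, §3 (proof of Thm 1)] -/
theorem pairInd_reflL_of_mid_cut (hL : Even L) (h4 : 4 ≤ L) (t : ZMod L → ℂ) {j : ZMod L}
    (h₁ : ¬IsLeftBond (j + 1)) (h₂ : ¬IsRightBond (j + 1)) : pairInd (reflL t) j = 1 := by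
  have hm := bondRefl_eq_add_two_of_mid_cut hL h4 h₁ h₂
  rw [pairInd, if_pos]
  rcases left_or_right_of_mid_cut h4 h₁ h₂ with hl | hr
  · have hr2 : IsRightBond (j + 2) := by rw [← hm]; exact (isRightBond_bondRefl_iff hL j).2 hl
    rw [reflL_of_not_isRightBond t (fun hr => hr.not_isLeftBond hl), reflL_apply, if_pos hr2, ← hm,
      bondRefl_bondRefl, norm_neg, norm_star]
  · have hl2 : IsLeftBond (j + 2) := by rw [← hm]; exact (isLeftBond_bondRefl_iff hL j).2 hr
    rw [reflL_apply t j, if_pos hr, hm, reflL_of_not_isRightBond t (fun hr' => hr'.not_isLeftBond hl2),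
      norm_neg, norm_star]

/-- **A pair straddling the plane becomes a pair of identical moduli** under `reflR`.
[cite: LiebNachtergaele1995, §3 (proof of Thm 1)] -/
theorem pairInd_reflR_of_mid_cut (hL : Even L) (h4 : 4 ≤ L) (t : ZMod L → ℂ) {j : ZMod L}
    (h₁ : ¬IsLeftBond (j + 1)) (h₂ : ¬IsRightBond (j + 1)) : pairInd (reflR t) j = 1 := by
  have hm := bondRefl_eq_add_two_of_mid_cut hL h4 h₁ h₂
  rw [pairInd, if_pos]
  rcases left_or_right_of_mid_cut h4 h₁ h₂ with hl | hr
  · have hr2 : IsRightBond (j + 2) := by rw [← hm]; exact (isRightBond_bondRefl_iff hL j).2 hl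
    rw [reflR_apply t j, if_pos hl, hm, reflR_of_not_isLeftBond t hr2.not_isLeftBond, norm_neg,
      norm_star]
  · have hl2 : IsLeftBond (j + 2) := by rw [← hm]; exact (isLeftBond_bondRefl_iff hL j).2 hr
    rw [reflR_of_not_isLeftBond t hr.not_isLeftBond, reflR_apply, if_pos hl2, ← hm, bondRefl_bondRefl,
      norm_neg, norm_star]

/-- **The pair count of `reflL t`**: twice the left-middle pairs of `t` plus all straddling pairs.
[cite: LiebNachtergaele1995, §3 (proof of Thm 1)] -/
theorem pairCount_reflL (hL : Even L) (h4 : 4 ≤ L) (t : ZMod L → ℂ) :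
    pairCount (reflL t) = 2 * ∑ j ∈ univ.filter (fun j => IsLeftBond (j + 1)), pairInd t j +
      #(univ.filter fun j : ZMod L => ¬IsLeftBond (j + 1) ∧ ¬IsRightBond (j + 1)) := by
  rw [pairCount_eq_sum, sum_pairs_split,
    sum_congr rfl (fun j hj => pairInd_reflL_of_mid_left t (mem_filter.1 hj).2),
    sum_congr rfl (fun j hj => pairInd_reflL_of_mid_right hL h4 t (mem_filter.1 hj).2),
    sum_pairRefl_right_eq_left hL,
    sum_congr rfl (fun j hj => pairInd_reflL_of_mid_cut hL h4 t (mem_filter.1 hj).2.1 (mem_filter.1 hj).2.2),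
    ← card_eq_sum_ones]
  ring

/-- **The pair count of `reflR t`**: twice the right-middle pairs of `t` plus all straddling pairs.
[cite: LiebNachtergaele1995, §3 (proof of Thm 1)] -/
theorem pairCount_reflR (hL : Even L) (h4 : 4 ≤ L) (t : ZMod L → ℂ) :
    pairCount (reflR t) = 2 * ∑ j ∈ univ.filter (fun j => IsRightBond (j + 1)), pairInd t j +
      #(univ.filter fun j : ZMod L => ¬IsLeftBond (j + 1) ∧ ¬IsRightBond (j + 1)) := by
  rw [pairCount_eq_sum, sum_pairs_split,
    sum_congr rfl (fun j hj => pairInd_reflR_of_mid_left hL h4 t (mem_filter.1 hj).2),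
    sum_congr rfl (fun j hj => pairInd_reflR_of_mid_right t (mem_filter.1 hj).2),
    sum_pairRefl_left_eq_right hL,
    sum_congr rfl (fun j hj => pairInd_reflR_of_mid_cut hL h4 t (mem_filter.1 hj).2.1 (mem_filter.1 hj).2.2),
    ← card_eq_sum_ones]
  ring

/-- **"Either `(t^l,t^m,θt^l)` or `(θt^r,t^m,t^r)` has at least as many pairs of identical `|t_j|`"**:
`N(reflL t) + N(reflR t) ≥ 2 N(t)`. [cite: LiebNachtergaele1995, §3 (proof of Thm 1)] -/
theorem two_mul_pairCount_le (hL : Even L) (h4 : 4 ≤ L) (t : ZMod L → ℂ) :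
    2 * pairCount t ≤ pairCount (reflL t) + pairCount (reflR t) := by
  have hS : ∑ j ∈ univ.filter (fun j => ¬IsLeftBond (j + 1) ∧ ¬IsRightBond (j + 1)), pairInd t j ≤
      #(univ.filter fun j : ZMod L => ¬IsLeftBond (j + 1) ∧ ¬IsRightBond (j + 1)) := by
    rw [card_eq_sum_ones]; exact sum_le_sum fun j _ => pairInd_le_one t j
  have ht := (pairCount_eq_sum t).trans (sum_pairs_split (pairInd t))
  rw [pairCount_reflL hL h4, pairCount_reflR hL h4]
  omega

/-- … **and strictly more if a pair straddling the plane is unequal**: if `|t_0| ≠ |t_{-2}|` then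
`N(reflL t) + N(reflR t) ≥ 2 N(t) + 2`. [cite: LiebNachtergaele1995, §3 (proof of Thm 1)] -/
theorem two_mul_pairCount_add_two_le (hL : Even L) (h4 : 4 ≤ L) {t : ZMod L → ℂ}
    (hne : ‖t 0‖ ≠ ‖t (-2)‖) : 2 * pairCount t + 2 ≤ pairCount (reflL t) + pairCount (reflR t) := by
  have hmem : (-2 : ZMod L) ∈ univ.filter (fun j : ZMod L => ¬IsLeftBond (j + 1) ∧ ¬IsRightBond (j + 1)) := by
    rw [mem_filter, show (-2 : ZMod L) + 1 = -1 by ring]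
    exact ⟨mem_univ _, cut_neg_one h4⟩
  have h0 : pairInd t (-2) = 0 := by
    rw [pairInd, if_neg]
    rwa [show (-2 : ZMod L) + 2 = 0 by ring]
  have hS : ∑ j ∈ univ.filter (fun j : ZMod L => ¬IsLeftBond (j + 1) ∧ ¬IsRightBond (j + 1)), pairInd t j + 1 ≤
      #(univ.filter fun j : ZMod L => ¬IsLeftBond (j + 1) ∧ ¬IsRightBond (j + 1)) := by
    rw [← sum_erase_add _ _ hmem, h0, add_zero]
    have h1 : ∑ j ∈ (univ.filter fun j : ZMod L => ¬IsLeftBond (j + 1) ∧ ¬IsRightBond (j + 1)).erase (-2),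
        pairInd t j ≤ #((univ.filter fun j : ZMod L => ¬IsLeftBond (j + 1) ∧ ¬IsRightBond (j + 1)).erase (-2)) := by
      rw [card_eq_sum_ones]; exact sum_le_sum fun j _ => pairInd_le_one t j
    have h2 := card_erase_of_mem hmem
    have h3 := card_pos.2 ⟨_, hmem⟩
    omega
  have ht := (pairCount_eq_sum t).trans (sum_pairs_split (pairInd t))
  rw [pairCount_reflL hL h4, pairCount_reflR hL h4]
  omega

end Pairs

/-! ### The descent: a minimiser with dimerized moduli and canonical flux -/

section Descent

/-- **One step of the proof of Theorem 1 at the plane `a`.** From a minimiser `t`: gauge the cut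
bonds of the plane real and nonnegative, reflect both ways; both reflected configurations are
minimisers (by `RPineq` and minimality) with the canonical flux, together they have at least
`2 N(t)` pairs of identical moduli, and at least `2 N(t) + 2` if the pair `(a - 2, a)` straddling the
plane is unequal. [cite: LiebNachtergaele1995, §3 (proof of Thm 1)] -/
theorem step (hL : Even L) (h4 : 4 ≤ L) (f : ℝ → ℝ) (U : ℝ) {t : ZMod L → ℂ}
    (hmin : IsMinimizer f U t) (a : ZMod L) :
    ∃ t₁ t₂ : ZMod L → ℂ, IsMinimizer f U t₁ ∧ IsMinimizer f U t₂ ∧ HasCanonicalFlux t₁ ∧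
      HasCanonicalFlux t₂ ∧ 2 * pairCount t ≤ pairCount t₁ + pairCount t₂ ∧
      (‖t (a - 2)‖ ≠ ‖t a‖ → 2 * pairCount t + 2 ≤ pairCount t₁ + pairCount t₂) := by
  have h3 : 3 ≤ L := by omega
  -- gauge the cut bonds real
  set t' := gauge (cutGauge a t) t with ht'
  have hg := norm_cutGauge a t
  have hmin' : IsMinimizer f U t' := hmin.gauge h3 hg
  have hnorm : ∀ j, ‖t' j‖ = ‖t j‖ := norm_gauge hg t
  obtain ⟨hc₂, hc₁⟩ := gauge_cutGauge_cut h4 a t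
  -- the two reflections
  set u := translate (-a) t' with hu
  have hu₁ : u (((L / 2 : ℕ) : ZMod L) - 1) = (‖t (a + ((L / 2 : ℕ) : ZMod L) - 1)‖ : ℂ) := by
    rw [hu, translate_apply, ← hc₁]; congr 1; ring
  have hu₂ : u (-1) = (‖t (a - 1)‖ : ℂ) := by
    rw [hu, translate_apply, ← hc₂]; congr 1; ring
  have hle := energy_reflLAt_add_energy_reflRAt_le hL h4 f U a (t := t') (norm_nonneg _) (norm_nonneg _)
    hc₁ hc₂
  obtain ⟨hmin₁, hmin₂⟩ := hmin'.of_add_le hle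
  refine ⟨reflLAt a t', reflRAt a t', hmin₁, hmin₂,
    hasCanonicalFlux_reflLAt hL h4 a (norm_nonneg _) (norm_nonneg _) hc₁ hc₂,
    hasCanonicalFlux_reflRAt hL h4 a (norm_nonneg _) (norm_nonneg _) hc₁ hc₂, ?_, ?_⟩
  · rw [reflLAt, reflRAt, pairCount_translate, pairCount_translate, ← pairCount_congr hnorm, ← hu,
      ← pairCount_translate (-a) t', ← hu]
    exact two_mul_pairCount_le hL h4 u
  · intro hne
    rw [reflLAt, reflRAt, pairCount_translate, pairCount_translate, ← pairCount_congr hnorm, ← hu,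
      ← pairCount_translate (-a) t', ← hu]
    refine two_mul_pairCount_add_two_le hL h4 fun h => hne ?_
    rw [hu, translate_apply, translate_apply, hnorm, hnorm, sub_neg_eq_add, sub_neg_eq_add, zero_add,
      show (-2 : ZMod L) + a = a - 2 by ring] at h
    exact h.symm

/-- A minimiser all of whose pairs are identical yields one with, in addition, the canonical flux.
[cite: LiebNachtergaele1995, §3 (proof of Thm 1)] -/
theorem flux_step (hL : Even L) (h4 : 4 ≤ L) (f : ℝ → ℝ) (U : ℝ) {t : ZMod L → ℂ}
    (hmin : IsMinimizer f U t) (hall : ∀ j, ‖t (j + 2)‖ = ‖t j‖) :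
    ∃ t' : ZMod L → ℂ, IsMinimizer f U t' ∧ HasCanonicalFlux t' ∧ ∀ j, ‖t' (j + 2)‖ = ‖t' j‖ := by
  obtain ⟨t₁, t₂, h₁, -, hf₁, -, hc, -⟩ := step hL h4 f U hmin 0
  have hN : pairCount t = L := by
    unfold pairCount
    rw [filter_true_of_mem (fun j _ => hall j), card_univ, ZMod.card]
  have h₂le := pairCount_le t₂
  exact ⟨t₁, h₁, hf₁, forall_norm_eq_of_le_pairCount (by omega)⟩

/-- **The descent of the proof of Theorem 1**: from any minimiser, a minimiser whose moduli are
dimerized (`|t_{j+2}| = |t_j|` for all `j`) and whose flux is canonical, by induction on the number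
of unequal pairs ("because `𝓔_L` is translation invariant, the argument can be repeated … yielding
finally a minimizing configuration in which all pairs are identical").
[cite: LiebNachtergaele1995, §3 (proof of Thm 1)] -/
theorem exists_minimizer_dimerized_moduli (hL : Even L) (h4 : 4 ≤ L) (f : ℝ → ℝ) (U : ℝ)
    {t : ZMod L → ℂ} (hmin : IsMinimizer f U t) :
    ∃ t' : ZMod L → ℂ, IsMinimizer f U t' ∧ HasCanonicalFlux t' ∧ ∀ j, ‖t' (j + 2)‖ = ‖t' j‖ := by
  suffices h : ∀ n : ℕ, ∀ t : ZMod L → ℂ, IsMinimizer f U t → L - pairCount t ≤ n →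
      ∃ t' : ZMod L → ℂ, IsMinimizer f U t' ∧ HasCanonicalFlux t' ∧ ∀ j, ‖t' (j + 2)‖ = ‖t' j‖ from
    h _ t hmin le_rfl
  intro n
  induction n with
  | zero =>
    intro t ht hn
    exact flux_step hL h4 f U ht (forall_norm_eq_of_le_pairCount (by omega))
  | succ n ih =>
    intro t ht hn
    by_cases hall : ∀ j, ‖t (j + 2)‖ = ‖t j‖
    · exact flux_step hL h4 f U ht hall
    · obtain ⟨j₀, hj₀⟩ := not_forall.1 hall
      obtain ⟨t₁, t₂, h₁, h₂, -, -, -, hc⟩ := step hL h4 f U ht (j₀ + 2)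
      have hc' := hc (by rw [add_sub_cancel_right]; exact fun h => hj₀ h.symm)
      have hlt : pairCount t < L := by
        by_contra hge
        exact hj₀ (forall_norm_eq_of_le_pairCount (by omega) j₀)
      have hle₁ := pairCount_le t₁
      have hle₂ := pairCount_le t₂
      by_cases h1 : pairCount t + 1 ≤ pairCount t₁
      · exact ih t₁ h₁ (by omega)
      · exact ih t₂ h₂ (by omega)

end Descent

/-! ### The gauge normal form and Theorem 1 -/

section NormalForm

/-- **The normal-form gauge based at the site `a`**: `g_x = Π_{a ≤ y < x} conj(phase t_y)` along the
ring from `a`. It makes every bond amplitude real and nonnegative except possibly `t_{a-1}`.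
[cite: LiebNachtergaele1995, §1 (gauge transformation; "the spectrum of `H` depends only on the total flux")] -/
def nfGauge (a : ZMod L) (t : ZMod L → ℂ) : ZMod L → ℂ := fun x =>
  ∏ i ∈ range (x - a).val, star (phase (t (a + i)))

omit [NeZero L] in
/-- Unfolding lemma. [cite: LiebNachtergaele1995, §1] -/
theorem nfGauge_apply (a : ZMod L) (t : ZMod L → ℂ) (x : ZMod L) :
    nfGauge a t x = ∏ i ∈ range (x - a).val, star (phase (t (a + i))) := rfl

omit [NeZero L] in
/-- The normal-form gauge consists of phases. [cite: LiebNachtergaele1995, §1] -/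
theorem norm_nfGauge (a : ZMod L) (t : ZMod L → ℂ) (x : ZMod L) : ‖nfGauge a t x‖ = 1 := by
  rw [nfGauge_apply, Complex.norm_prod]
  exact prod_eq_one fun i _ => by rw [norm_star, norm_phase]

/-- **In the normal-form gauge every bond other than `a - 1` is real and nonnegative**:
`t'_j = |t_j|` for `j ≠ a - 1`. [cite: LiebNachtergaele1995, §1 and eq. (1.8) (`α = 0`)] -/
theorem gauge_nfGauge_of_ne (h2 : 2 ≤ L) (a : ZMod L) (t : ZMod L → ℂ) {j : ZMod L} (hj : j ≠ a - 1) :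
    gauge (nfGauge a t) t j = (‖t j‖ : ℂ) := by
  have hval : (j + 1 - a).val = (j - a).val + 1 := by
    have hlt := ZMod.val_lt (j - a)
    have hne : (j - a).val ≠ L - 1 := by
      intro h
      apply hj
      have : j - a = -1 := by
        rw [← ZMod.natCast_zmod_val (j - a), h, Nat.cast_sub (by omega), Nat.cast_one,
          ZMod.natCast_self, zero_sub]
      linear_combination this
    rw [show j + 1 - a = j - a + 1 by ring, val_add_one h2, Nat.mod_eq_of_lt (by omega)]
  have hP := norm_nfGauge a t j
  rw [gauge_apply, nfGauge_apply a t (j + 1), hval, prod_range_succ, ZMod.natCast_zmod_val,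
    add_sub_cancel, ← nfGauge_apply]
  set P := nfGauge a t j
  calc P * star (phase (t j)) * star P * t j = (P * star P) * (star (phase (t j)) * t j) := by ring
    _ = (‖t j‖ : ℂ) := by
      rw [star_phase_mul, Complex.star_def, Complex.mul_conj', hP]; push_cast; ring

/-- **The normal form when the base bond is already real and nonnegative** (in particular when it
vanishes): all `t'_j = |t_j|`. [cite: LiebNachtergaele1995, §1 and eq. (1.8)] -/
theorem gauge_nfGauge_eq_norm (h2 : 2 ≤ L) (a : ZMod L) (t : ZMod L → ℂ)
    (ha : gauge (nfGauge a t) t (a - 1) = (‖t (a - 1)‖ : ℂ)) (j : ZMod L) :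
    gauge (nfGauge a t) t j = (‖t j‖ : ℂ) := by
  by_cases hj : j = a - 1
  · rw [hj, ha]
  · exact gauge_nfGauge_of_ne h2 a t hj

/-- The product of the bond amplitudes in the normal form: `Π_j t'_j = t'_{a-1} · Π_{j ≠ a-1} |t_j|`.
[cite: LiebNachtergaele1995, §1] -/
theorem bondProd_gauge_nfGauge (h2 : 2 ≤ L) (a : ZMod L) (t : ZMod L → ℂ) :
    bondProd (gauge (nfGauge a t) t) =
      gauge (nfGauge a t) t (a - 1) * ((∏ j ∈ univ.erase (a - 1), ‖t j‖ : ℝ) : ℂ) := by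
  rw [bondProd, ← mul_prod_erase univ _ (mem_univ (a - 1)), Complex.ofReal_prod]
  congr 1
  exact prod_congr rfl fun j hj => gauge_nfGauge_of_ne h2 a t (ne_of_mem_erase hj)

/-- From a real nonnegative configuration of the moduli: a dimerized real nonnegative minimiser.
[cite: LiebNachtergaele1995, §3 (proof of Thm 1)] -/
theorem conclude_of_eq_norm {f : ℝ → ℝ} {U : ℝ} {t s : ZMod L → ℂ} (hs : IsMinimizer f U s)
    (hmod : ∀ j, ‖t (j + 2)‖ = ‖t j‖) (heq : ∀ j, s j = (‖t j‖ : ℂ)) :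
    IsMinimizer f U s ∧ IsDimerized s ∧ ∀ j, s j = (‖s j‖ : ℂ) := by
  refine ⟨hs, fun j => by rw [heq, heq, hmod], fun j => ?_⟩
  rw [heq, Complex.norm_real, norm_norm]

/-- **Theorem 1 (i) of Lieb–Nachtergaele** (`L ≡ 2 mod 4`, flux `0`). For the half-filled
Peierls–Hubbard ring (1.1) with `L ≡ 2 (mod 4)` sites, any real `U` and any elastic energy `f`: if
the minimum of `𝓔_L({t_j}) = λ₀(H({t_j})) + Σ_j f(|t_j|)` over all complex bond configurations is
attained, then it is attained at a DIMERIZED configuration (`t_{j+2} = t_j`) all of whose `t_j` are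
real and nonnegative (flux `0`). [cite: LiebNachtergaele1995, Theorem 1 (`L = 2 mod 4`)] -/
theorem exists_dimerized_minimizer_of_mod_four_eq_two (hL4 : L % 4 = 2) (h4 : 4 ≤ L) (f : ℝ → ℝ)
    (U : ℝ) {t : ZMod L → ℂ} (hmin : IsMinimizer f U t) :
    ∃ t' : ZMod L → ℂ, IsMinimizer f U t' ∧ energy f U t' = energy f U t ∧ IsDimerized t' ∧
      ∀ j, t' j = (‖t' j‖ : ℂ) := by
  have hL : Even L := ⟨L / 2, by omega⟩
  have h2 : 2 ≤ L := by omega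
  have h3 : 3 ≤ L := by omega
  obtain ⟨s, hs, ⟨r, hr, hflux⟩, hmod⟩ := exists_minimizer_dimerized_moduli hL h4 f U hmin
  have hsign : ((-1 : ℂ)) ^ (L / 2 + 1) = 1 := Even.neg_one_pow ⟨(L / 2 + 1) / 2, by omega⟩
  rw [hsign, one_mul] at hflux
  have henergy : ∀ s', IsMinimizer f U s' → energy f U s' = energy f U t := fun s' hs' =>
    le_antisymm (hs' t) (hmin s')
  by_cases hz : ∃ j₁, s j₁ = 0
  · obtain ⟨j₁, hj₁⟩ := hz
    have hbase : gauge (nfGauge (j₁ + 1) s) s (j₁ + 1 - 1) = (‖s (j₁ + 1 - 1)‖ : ℂ) := by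
      rw [add_sub_cancel_right, hj₁, norm_zero, Complex.ofReal_zero, gauge_apply, hj₁, mul_zero]
    have hs' : IsMinimizer f U (gauge (nfGauge (j₁ + 1) s) s) := hs.gauge h3 (norm_nfGauge _ s)
    obtain ⟨h₁, h₂, h₃⟩ := conclude_of_eq_norm hs' hmod (gauge_nfGauge_eq_norm h2 (j₁ + 1) s hbase)
    exact ⟨_, h₁, henergy _ h₁, h₂, h₃⟩
  · rw [not_exists] at hz
    have hs' : IsMinimizer f U (gauge (nfGauge 0 s) s) := hs.gauge h3 (norm_nfGauge _ s)
    -- the base bond `-1`: `c · Π_{j ≠ -1} |s_j| = r ≥ 0`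
    have hppos : 0 < ∏ j ∈ univ.erase ((0 : ZMod L) - 1), ‖s j‖ :=
      prod_pos fun j _ => norm_pos_iff.2 (hz j)
    have hprod := bondProd_gauge_nfGauge h2 0 s
    rw [bondProd_gauge (norm_nfGauge 0 s), hflux] at hprod
    have hc : gauge (nfGauge 0 s) s (0 - 1) =
        ((r / ∏ j ∈ univ.erase ((0 : ZMod L) - 1), ‖s j‖ : ℝ) : ℂ) := by
      rw [Complex.ofReal_div, eq_div_iff (Complex.ofReal_ne_zero.2 hppos.ne'), ← hprod]
    have hbase : gauge (nfGauge 0 s) s (0 - 1) = (‖s (0 - 1)‖ : ℂ) := by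
      rw [← norm_gauge (norm_nfGauge 0 s) s (0 - 1), hc, Complex.norm_real,
        Real.norm_of_nonneg (div_nonneg hr hppos.le)]
    obtain ⟨h₁, h₂, h₃⟩ := conclude_of_eq_norm hs' hmod (gauge_nfGauge_eq_norm h2 0 s hbase)
    exact ⟨_, h₁, henergy _ h₁, h₂, h₃⟩

/-- **Theorem 1 (ii) of Lieb–Nachtergaele** (`L ≡ 0 mod 4`, flux `π`). For the half-filled
Peierls–Hubbard ring (1.1) with `4 ∣ L` sites, any real `U` and any `f`: if the minimum of `𝓔_L` is
attained, then it is attained at a real configuration whose MODULI are dimerized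
(`|t_{j+2}| = |t_j|`), with one bond `t_{j₁} ≤ 0` and all other `t_j ≥ 0` (flux `π`; eq. (1.8) with
`α = 0`: "the `t_j`'s themselves are not"). [cite: LiebNachtergaele1995, Theorem 1 (`L = 0 mod 4`) and eq. (1.8)] -/
theorem exists_dimerized_minimizer_of_four_dvd (h4dvd : 4 ∣ L) (h4 : 4 ≤ L) (f : ℝ → ℝ) (U : ℝ)
    {t : ZMod L → ℂ} (hmin : IsMinimizer f U t) :
    ∃ t' : ZMod L → ℂ, IsMinimizer f U t' ∧ energy f U t' = energy f U t ∧
      IsDimerized (fun j => ‖t' j‖) ∧ (∀ j, (t' j).im = 0) ∧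
      ∃ j₁, (t' j₁).re ≤ 0 ∧ ∀ j, j ≠ j₁ → 0 ≤ (t' j).re := by
  have hL : Even L := ⟨L / 2, by omega⟩
  have h2 : 2 ≤ L := by omega
  have h3 : 3 ≤ L := by omega
  obtain ⟨s, hs, ⟨r, hr, hflux⟩, hmod⟩ := exists_minimizer_dimerized_moduli hL h4 f U hmin
  have hsign : ((-1 : ℂ)) ^ (L / 2 + 1) = -1 := Odd.neg_one_pow ⟨(L / 2 + 1) / 2, by omega⟩
  rw [hsign, neg_one_mul] at hflux
  have henergy : ∀ s', IsMinimizer f U s' → energy f U s' = energy f U t := fun s' hs' =>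
    le_antisymm (hs' t) (hmin s')
  by_cases hz : ∃ j₁, s j₁ = 0
  · obtain ⟨j₁, hj₁⟩ := hz
    have hbase : gauge (nfGauge (j₁ + 1) s) s (j₁ + 1 - 1) = (‖s (j₁ + 1 - 1)‖ : ℂ) := by
      rw [add_sub_cancel_right, hj₁, norm_zero, Complex.ofReal_zero, gauge_apply, hj₁, mul_zero]
    have hs' : IsMinimizer f U (gauge (nfGauge (j₁ + 1) s) s) := hs.gauge h3 (norm_nfGauge _ s)
    have heq := gauge_nfGauge_eq_norm h2 (j₁ + 1) s hbase
    refine ⟨gauge (nfGauge (j₁ + 1) s) s, hs', henergy _ hs', fun j => ?_, fun j => ?_, j₁, ?_,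
      fun j _ => ?_⟩
    · change ‖gauge (nfGauge (j₁ + 1) s) s (j + 2)‖ = ‖gauge (nfGauge (j₁ + 1) s) s j‖
      rw [heq, heq, hmod]
    · rw [heq, Complex.ofReal_im]
    · rw [heq, hj₁, norm_zero, Complex.ofReal_re]
    · rw [heq, Complex.ofReal_re]; exact norm_nonneg _
  · rw [not_exists] at hz
    have hs' : IsMinimizer f U (gauge (nfGauge 0 s) s) := hs.gauge h3 (norm_nfGauge _ s)
    have hppos : 0 < ∏ j ∈ univ.erase ((0 : ZMod L) - 1), ‖s j‖ :=
      prod_pos fun j _ => norm_pos_iff.2 (hz j)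
    have hprod := bondProd_gauge_nfGauge h2 0 s
    rw [bondProd_gauge (norm_nfGauge 0 s), hflux] at hprod
    have hc : gauge (nfGauge 0 s) s (0 - 1) =
        ((-(r / ∏ j ∈ univ.erase ((0 : ZMod L) - 1), ‖s j‖) : ℝ) : ℂ) := by
      rw [Complex.ofReal_neg, Complex.ofReal_div, neg_div',
        eq_div_iff (Complex.ofReal_ne_zero.2 hppos.ne'), ← hprod]
    have hne : ∀ j, j ≠ (0 : ZMod L) - 1 → gauge (nfGauge 0 s) s j = (‖s j‖ : ℂ) := fun j hj =>
      gauge_nfGauge_of_ne h2 0 s hj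
    refine ⟨gauge (nfGauge 0 s) s, hs', henergy _ hs', fun j => ?_, fun j => ?_, 0 - 1, ?_,
      fun j hj => ?_⟩
    · change ‖gauge (nfGauge 0 s) s (j + 2)‖ = ‖gauge (nfGauge 0 s) s j‖
      rw [norm_gauge (norm_nfGauge 0 s), norm_gauge (norm_nfGauge 0 s), hmod]
    · by_cases hj : j = 0 - 1
      · rw [hj, hc, Complex.ofReal_im]
      · rw [hne j hj, Complex.ofReal_im]
    · rw [hc, Complex.ofReal_re, neg_nonpos]; exact div_nonneg hr hppos.le
    · rw [hne j hj, Complex.ofReal_re]; exact norm_nonneg _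

end NormalForm

/-! ### The flux-phase corollary for even rings (reflection-symmetric moduli) -/

section FluxPhase

/-- The ground-state energy is gauge invariant (the elastic-free case of `energy_gauge`).
[cite: LiebNachtergaele1995, §1] -/
theorem groundEnergy_gauge (h3 : 3 ≤ L) {g : ZMod L → ℂ} (hg : ∀ j, ‖g j‖ = 1) (U : ℝ)
    (t : ZMod L → ℂ) : (hamiltonian U (gauge g t)).groundEnergy = (hamiltonian U t).groundEnergy := by
  have h := energy_gauge h3 hg (fun _ => 0) U t
  simpa only [energy, sum_const_zero, add_zero] using h

/-- **"The energy levels depend only on the total flux"** (and the moduli): two configurations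
with the same moduli `|t_j|` and the same product `Π_j t_j` have the same ground-state energy —
they have the same gauge normal form. [cite: LiebNachtergaele1995, §1 (gauge transformation, total flux `Φ`)] -/
theorem groundEnergy_eq_of_norm_eq_of_bondProd_eq (h3 : 3 ≤ L) (U : ℝ) {t t' : ZMod L → ℂ}
    (hn : ∀ j, ‖t j‖ = ‖t' j‖) (hp : bondProd t = bondProd t') :
    (hamiltonian U t).groundEnergy = (hamiltonian U t').groundEnergy := by
  have h2 : 2 ≤ L := by omega
  -- the normal forms based at `a` agree as soon as the base bond vanishes or no bond vanishes
  have key : ∀ a : ZMod L, (t (a - 1) = 0 ∨ ∀ j, t j ≠ 0) →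
      gauge (nfGauge a t) t = gauge (nfGauge a t') t' := by
    intro a ha
    funext j
    by_cases hj : j = a - 1
    · rw [hj]
      rcases ha with h0 | hall
      · have h0' : t' (a - 1) = 0 := by rw [← norm_eq_zero, ← hn, h0, norm_zero]
        rw [gauge_apply, gauge_apply, h0, h0', mul_zero, mul_zero]
      · have hP : (∏ j ∈ univ.erase (a - 1), ‖t j‖ : ℝ) = ∏ j ∈ univ.erase (a - 1), ‖t' j‖ :=
          prod_congr rfl fun j _ => hn j
        have hpos : 0 < ∏ j ∈ univ.erase (a - 1), ‖t j‖ := prod_pos fun j _ => norm_pos_iff.2 (hall j)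
        have e1 := bondProd_gauge_nfGauge h2 a t
        have e2 := bondProd_gauge_nfGauge h2 a t'
        rw [bondProd_gauge (norm_nfGauge a t)] at e1
        rw [bondProd_gauge (norm_nfGauge a t'), ← hp, e1, ← hP] at e2
        exact mul_right_cancel₀ (Complex.ofReal_ne_zero.2 hpos.ne') e2
    · rw [gauge_nfGauge_of_ne h2 a t hj, gauge_nfGauge_of_ne h2 a t' hj, hn j]
  have conclude : ∀ a : ZMod L, (t (a - 1) = 0 ∨ ∀ j, t j ≠ 0) →
      (hamiltonian U t).groundEnergy = (hamiltonian U t').groundEnergy := by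
    intro a ha
    rw [← groundEnergy_gauge h3 (norm_nfGauge a t) U t, key a ha,
      groundEnergy_gauge h3 (norm_nfGauge a t') U t']
  by_cases hz : ∃ j₁, t j₁ = 0
  · obtain ⟨j₁, hj₁⟩ := hz
    exact conclude (j₁ + 1) (Or.inl (by rw [add_sub_cancel_right]; exact hj₁))
  · exact conclude 0 (Or.inr fun j hj => hz ⟨j, hj⟩)

/-- The moduli of the left-symmetrised configuration of the plane `a`: `|t_{2a-2-j}|` on the bonds
to the right of the plane (relative coordinate `j - a` a right bond), `|t_j|` elsewhere.
[cite: LiebNachtergaele1995, §3] -/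
theorem norm_reflLAt (a : ZMod L) (t : ZMod L → ℂ) (j : ZMod L) :
    ‖reflLAt a t j‖ = if IsRightBond (j - a) then ‖t (2 * a - 2 - j)‖ else ‖t j‖ := by
  rw [reflLAt, translate_apply, reflL_apply]
  split_ifs
  · rw [norm_neg, norm_star, translate_apply, bondRefl]
    congr 2; ring
  · rw [translate_apply]
    congr 2; ring

/-- The moduli of the right-symmetrised configuration of the plane `a`.
[cite: LiebNachtergaele1995, §3] -/
theorem norm_reflRAt (a : ZMod L) (t : ZMod L → ℂ) (j : ZMod L) :
    ‖reflRAt a t j‖ = if IsLeftBond (j - a) then ‖t (2 * a - 2 - j)‖ else ‖t j‖ := by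
  rw [reflRAt, translate_apply, reflR_apply]
  split_ifs
  · rw [norm_neg, norm_star, translate_apply, bondRefl]
    congr 2; ring
  · rw [translate_apply]
    congr 2; ring

/-- The modulus of the flux factor: `|Π_j t_j| = Π_j |t_j|`, so a canonical flux is
`Π_j t_j = (-1)^{L/2+1} Π_j |t_j|`. [cite: LiebNachtergaele1995, §1 (total flux)] -/
theorem HasCanonicalFlux.bondProd_eq {t : ZMod L → ℂ} (h : HasCanonicalFlux t) :
    bondProd t = (-1) ^ (L / 2 + 1) * ((∏ j, ‖t j‖ : ℝ) : ℂ) := by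
  obtain ⟨r, hr, hflux⟩ := h
  have hnorm : ‖bondProd t‖ = r := by
    rw [hflux, norm_mul, norm_pow, norm_neg, norm_one, one_pow, one_mul, Complex.norm_real,
      Real.norm_of_nonneg hr]
  rw [hflux, ← hnorm, bondProd, Complex.norm_prod]

/-- **Corollary (the flux phase of even rings, all `U`), reflection-symmetric moduli.**
[LiebNachtergaele1995, Corollary `fluxphase`]: "Let `U_j ≡ U` and let `{t_j}` be a fixed
configuration of nonnegative `t_j`'s. Then the minimum of `𝓔_L`, varying over the total flux `Φ`
alone, is attained for `Φ = 0` if `L ≡ 2 mod 4` and for `Φ = π` if `L ≡ 0 mod 4`." Here is what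
Lemma 3.1 (`RPineq`) yields (the printed corollary carries no proof): if the moduli are symmetric
under the reflection in one pair of planes through bonds (`|t_{2a-2-j}| = |t_j|`; e.g. uniform or
dimerized moduli), then for every configuration `t` with these moduli there is one with the same
moduli, the CANONICAL flux `Π t_j = (-1)^{L/2-1}|Π t_j|`, and no larger ground-state energy.
[cite: LiebNachtergaele1995, Corollary (fluxphase) and Lemma 3.1] [cite: Lieb1994, Theorem (rings)] -/
theorem exists_canonicalFlux_groundEnergy_le (hL : Even L) (h4 : 4 ≤ L) (U : ℝ) (a : ZMod L)
    {t : ZMod L → ℂ} (hsym : ∀ j, ‖t (2 * a - 2 - j)‖ = ‖t j‖) :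
    ∃ t' : ZMod L → ℂ, (∀ j, ‖t' j‖ = ‖t j‖) ∧ HasCanonicalFlux t' ∧
      (hamiltonian U t').groundEnergy ≤ (hamiltonian U t).groundEnergy := by
  -- TODO(general form): arbitrary nonnegative moduli, as printed in [LiebNachtergaele1995,
  -- Corollary fluxphase] (no proof is printed; `RPineq` needs the reflection symmetry).
  have h3 : 3 ≤ L := by omega
  have hg := norm_cutGauge a t
  have hn₀ : ∀ j, ‖gauge (cutGauge a t) t j‖ = ‖t j‖ := norm_gauge hg t
  have hE₀ := groundEnergy_gauge h3 hg U t
  obtain ⟨hc₂, hc₁⟩ := gauge_cutGauge_cut h4 a t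
  have hle := energy_reflLAt_add_energy_reflRAt_le hL h4 (fun _ => 0) U a (t := gauge (cutGauge a t) t)
    (norm_nonneg _) (norm_nonneg _) hc₁ hc₂
  simp only [energy, sum_const_zero, add_zero] at hle
  have hfl₁ := hasCanonicalFlux_reflLAt hL h4 a (norm_nonneg _) (norm_nonneg _) hc₁ hc₂
  have hfl₂ := hasCanonicalFlux_reflRAt hL h4 a (norm_nonneg _) (norm_nonneg _) hc₁ hc₂
  have hnL : ∀ j, ‖reflLAt a (gauge (cutGauge a t) t) j‖ = ‖t j‖ := fun j => by
    rw [norm_reflLAt]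
    split_ifs
    · rw [hn₀, hsym]
    · exact hn₀ j
  have hnR : ∀ j, ‖reflRAt a (gauge (cutGauge a t) t) j‖ = ‖t j‖ := fun j => by
    rw [norm_reflRAt]
    split_ifs
    · rw [hn₀, hsym]
    · exact hn₀ j
  by_cases h : (hamiltonian U (reflLAt a (gauge (cutGauge a t) t))).groundEnergy ≤
      (hamiltonian U t).groundEnergy
  · exact ⟨_, hnL, hfl₁, h⟩
  · exact ⟨_, hnR, hfl₂, by linarith [not_le.1 h]⟩

/-- **The canonical flux minimises the ground-state energy over the flux** (reflection-symmetric
moduli, all real `U`, even `L ≥ 4`): any configuration `t'` with the moduli of `t` and the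
canonical flux has `λ₀(H(t')) ≤ λ₀(H(t))`.
[cite: LiebNachtergaele1995, Corollary (fluxphase)] [cite: Lieb1994, Theorem (rings)] -/
theorem groundEnergy_le_of_hasCanonicalFlux (hL : Even L) (h4 : 4 ≤ L) (U : ℝ) (a : ZMod L)
    {t t' : ZMod L → ℂ} (hsym : ∀ j, ‖t (2 * a - 2 - j)‖ = ‖t j‖) (hn : ∀ j, ‖t' j‖ = ‖t j‖)
    (hfl : HasCanonicalFlux t') :
    (hamiltonian U t').groundEnergy ≤ (hamiltonian U t).groundEnergy := by
  have h3 : 3 ≤ L := by omega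
  obtain ⟨t'', hn'', hfl'', hle⟩ := exists_canonicalFlux_groundEnergy_le hL h4 U a hsym
  have hp : bondProd t' = bondProd t'' := by
    rw [hfl.bondProd_eq, hfl''.bondProd_eq]
    simp only [hn, hn'']
  rwa [groundEnergy_eq_of_norm_eq_of_bondProd_eq h3 U (fun j => (hn j).trans (hn'' j).symm) hp]

end FluxPhase

end PeierlsRing

end Literature.MathematicalPhysics.QuantumLattice

end
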